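import Literature.Geometry.Riemannian.NeumannIsotropicFormPos
import Literature.Geometry.Riemannian.ConformalIsotropicCurvature
import Literature.Geometry.Riemannian.YamabePositivity
import Literature.Geometry.Lorentzian.AFLinearWeakExistence
import Literature.Geometry.Lorentzian.GreenIdentity
import Literature.Geometry.Lorentzian.GreenIdentityCompactSupport
import Literature.Geometry.Lorentzian.ChartLaplacian
import Literature.Geometry.Lorentzian.VolumePositivity
import Literature.Geometry.Lorentzian.WeakSolutionRegularity
import Literature.Geometry.Lorentzian.HopfPositivity
import Literature.Geometry.Lorentzian.DalembertianCompose
import Literature.Geometry.Lorentzian.EnergyCurrents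
import Literature.Analysis.Distribution.EllipticRegularityProofs
import Mathlib.Geometry.Manifold.PartitionOfUnity
import HarnessLib

/-!
# Chen–Zhu 2014, Cor. 2.2 with §3 in dimension four — PROOF of the named fact
# `chenZhu2014_conformal_pic_four` (`ChenZhuConformalPIC.lean`)

Source: Bing-Long Chen, Xi-Ping Zhu, *A conformally invariant classification theorem in four
dimensions*, Comm. Anal. Geom. **22** (2014) 811–831 = arXiv:1206.5051 (**[ChenZhu2014]**; held,
read: PDF p. 7, Cor. 2.2 "If `𝒴_f(Mⁿ,𝒞) > 0`, then there exists `g̃ ∈ 𝒞` such that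
`R_{g̃} − f(W_{g̃}) > 0`" — "earlier obtained in [GLe] (see Proposition 3 in [GLe])" = Gursky–LeBrun;
PDF p. 9, §3, first paragraph of the proof of Thm. 1.1: with `σ_g = R_g − 6 max{λ_max(W₊), λ_max(W₋)}`,
"there exists a `g ∈ 𝒞` such that `σ_g > 0` … In other words, `(M⁴, g)` has positive isotropic
curvature"). The fact (statement unchanged, see `ChenZhuConformalPIC.lean` for the transcription:
`σ_g = 3 · minIsotropicCurvature`, `n = 4`, smooth representative) is discharged here as
`chenZhu2014_conformal_pic_four_holds`; this is a sibling `…Proofs` file because the proof needs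
`NeumannIsotropicFormPos.lean` (continuity and minimality of `minIsotropicCurvature`), which imports
`ChenZhuConformalPIC.lean`.

## The proof formalised (an independent route to Cor. 2.2, library-first)

Chen–Zhu obtain Cor. 2.2 from their Lemma 2.1 (solution of the generalized Yamabe problem by
subcritical regularisation); Gursky–LeBrun's Prop. 3 uses the first eigenfunction of the modified
conformal Laplacian. Neither spectral theory nor the subcritical Yamabe problem being available, we
solve instead the *coercive* equation `−6Δ_G u + σ̃ u = 1` for a smooth `σ̃` slightly below
`σ_G = 3 iso_min` and show `u > 0`; then `−6Δ_G u + σ_G u ≥ −6Δ_G u + σ̃ u = 1 > 0`, which is the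
positivity of `σ_{u²G} = u⁻³(−6Δ_G u + σ_G u)` ((2.8) at `n = 4`), i.e. frame-wise
`iso_{u²G}(e/u) = u⁻³(u · iso_G(e) − 2Δ_G u) > 0` — positive isotropic curvature of `u² G` (§3).

* **Geometry** (`exists_conformal_sq_metric`, `hasPositiveIsotropicCurvature_of_conformal_sq`,
  `exists_conformal_sq_hasPositiveIsotropicCurvature`): the conformal transformation law of the
  isotropic curvature in dimension four (`ConformalIsotropicCurvature.lean`:
  `iso_{u²G}(e') = u⁻² iso_G(u e') − 2u⁻³ □_G u` on a `u²G`-orthonormal frame `e'`, for every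
  Levi-Civita connection of `u²G`; Besse 1987, Thm. 1.159 (b) contracted over an isotropic 2-plane)
  and `iso_G(u e') ≥ iso_min` (`minIsotropicCurvature_le`) give
  `iso_{u²G}(e') ≥ u⁻³(u · iso_min − 2Δ_G u) > 0`.
* **Analysis** (`exists_veryWeakSolution_of_coercive`, `exists_contMDiff_ae_eq_dalembertian_sub_mul_eq`,
  `coercive_of_coercive_pos`, `pos_of_dalembertian_eq_of_coercive`,
  `exists_pos_smooth_two_mul_dalembertian_lt`): the hypothesis (coercivity `c‖u‖²_{L⁴} ≤
  ∫(6|∇u|² + 3 iso_min u²)` on smooth positive `u`) passes to all smooth `φ` (test `(φ² + δ²)^{1/2}`,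
  `δ → 0`); a smooth `σ̃` with `3 iso_min − ε < σ̃ < 3 iso_min` (partitions of unity) keeps coercivity
  with constant `c/2`; the Riesz–Lax–Milgram theorem on the completion of `C^∞(M)` under the form
  itself (the energy method of Schoen–Yau 1979, Lemma 3.2, as in `AFLinearWeakExistence.lean`) gives
  `u ∈ L⁴` with `∫ u(Δζ − (σ̃/6)ζ) = ∫(−1/6)ζ` for smooth `ζ`; interior regularity (Folland 1995,
  Cor. (6.34), `Folland1995_cor634_holds`, through the smooth-test-function variants of
  `WeakSolutionChart/Regularity`) makes `u` smooth with `−6Δu + σ̃u = 1`; `u ≥ 0` by testing against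
  the smooth functions `(u − (u² + δ²)^{1/2})/2 → −u⁻` (coercivity again), and `u > 0` by E. Hopf's
  minimum principle (`dalembertian_supersolution_eventually_eq`, López-Gómez 2012, Thm. 1.2).

Everything is proved; no definition and no statement of `Prop` type is introduced.

## References

* B.-L. Chen, X.-P. Zhu, Comm. Anal. Geom. 22 (2014) 811–831 = arXiv:1206.5051, §2 (2.8),
  Cor. 2.2 (PDF p. 7); §3, first paragraph of the proof of Thm. 1.1 (PDF p. 9). [ChenZhu2014]
* M. J. Gursky, C. LeBrun, Ann. Global Anal. Geom. 17 (1999) 315–328, Prop. 3 and §3.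
  [GurskyLebrun1999]
* A. L. Besse, *Einstein Manifolds*, Springer 1987, Thm. 1.159 (b). [Besse1987]
* R. Schoen, S.-T. Yau, Comm. Math. Phys. 65 (1979) 45–76, Lemma 3.2 and its proof (pp. 64–65).
  [SchoenYauPMT1979]
* D. Gilbarg, N. S. Trudinger, *Elliptic PDE of Second Order*, Springer 2001, Thm. 5.8.
  [GilbargTrudinger2001]
* G. B. Folland, *Introduction to Partial Differential Equations*, 2nd ed. (1995), Cor. (6.34).
  [Folland2020]
* J. López-Gómez, *Linear Second Order Elliptic Operators*, World Scientific 2013, Thm. 1.2.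
  [LopezGomez2012]
* I. Chavel, *Riemannian Geometry: A Modern Introduction*, 2nd ed., CUP 2006, §III.3, §III.7.
  [Chavel2006]
* B. O'Neill, *Semi-Riemannian geometry*, Academic Press 1983, Ch. 3, Prop. 3.59, pp. 60–61.
  [ONeill1983]
-/

noncomputable section

set_option maxSynthPendingDepth 3

open Bundle Set Function Filter Topology MeasureTheory Measure TopologicalSpace Manifold Module
open scoped Manifold ContDiff Topology

namespace Literature.Geometry.Riemannian

open Literature.Geometry.Lorentzian Literature.Geometry.Lorentzian.PseudoRiemannianMetric

section Geometry

/-! ### From `u · iso_min − 2 Δu > 0` to positive isotropic curvature of `u² G` -/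

section Assembly

variable {M : Type*} [TopologicalSpace M] [ChartedSpace (EuclideanSpace ℝ (Fin 4)) M]
  [IsManifold (𝓡 4) ∞ M]

/-- **The conformal metric `u² G`** of a smooth pseudo-Riemannian metric `G` by a smooth positive
function `u`: a smooth metric (`ContMDiff.smul_section`), Riemannian when `G` is. [folklore] -/
theorem exists_conformal_sq_metric
    (G : PseudoRiemannianMetric (𝓡 4) ∞ (EuclideanSpace ℝ (Fin 4)) (TangentSpace (𝓡 4) : M → Type _))
    (hG : G.IsRiemannian) {u : M → ℝ} (hu : ContMDiff (𝓡 4) 𝓘(ℝ) ∞ u) (hpos : ∀ x, 0 < u x) :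
    ∃ G' : PseudoRiemannianMetric (𝓡 4) ∞ (EuclideanSpace ℝ (Fin 4)) (TangentSpace (𝓡 4) : M → Type _),
      (∀ (x : M) (v w : TangentSpace (𝓡 4) x), G'.val x v w = u x ^ 2 * G.val x v w) ∧
        G'.IsRiemannian := by
  have hu2 : ContMDiff (𝓡 4) 𝓘(ℝ) ∞ fun x ↦ u x ^ 2 := (contDiff_id.pow 2).comp_contMDiff hu
  refine ⟨{ val := fun x ↦ (u x ^ 2) • G.val x
            symm := fun x v w ↦ ?_
            nondegenerate := fun x v hv ↦ G.nondegenerate x v fun w ↦ ?_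
            contMDiff := hu2.smul_section G.contMDiff }, fun _ _ _ ↦ rfl, fun x v hv ↦ ?_⟩
  · change u x ^ 2 * G.val x v w = u x ^ 2 * G.val x w v
    rw [G.symm x v w]
  · have h : u x ^ 2 * G.val x v w = 0 := hv w
    exact (mul_eq_zero.1 h).resolve_left (pow_ne_zero 2 (hpos x).ne')
  · change 0 < u x ^ 2 * G.val x v v
    exact mul_pos (pow_pos (hpos x) 2) (hG x v hv)

/-- **Positive isotropic curvature of a conformal metric from the pointwise inequality
`2 Δ_G u < u · iso_min`** (the frame-wise content of Chen–Zhu's §3, first paragraph: for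
`g̃ = u² g`, `σ_g̃ = u⁻³(−6Δ_g u + σ_g u)` with `σ = 3 · iso_min`, and "`σ_g̃ > 0` … In other words,
`(M⁴, g̃)` has positive isotropic curvature"). For a smooth Riemannian `G` on a `4`-manifold, a
smooth `u > 0` with `2 Δ_G u(x) < u(x) · minIsotropicCurvature G x` everywhere, and a smooth metric
`G' = u² G`, the metric `G'` has positive isotropic curvature: every Levi-Civita connection of `G'`
has the curvature tensor `G'.riemann` (`IsLeviCivita.curvature_eq_riemann`), a `G'`-orthonormal
frame `e'` is `e/u` for the `G`-orthonormal frame `e = u • e'`, and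
`iso_{G'}(e') = u⁻³(u · iso_G(e) − 2Δ_G u) ≥ u⁻³(u · iso_min − 2Δ_G u) > 0`
(`PseudoRiemannianMetric.isotropicCurvature_conformal_sq_four_of_isOrthonormalFrame` of
`ConformalIsotropicCurvature.lean`, `minIsotropicCurvature_le`).
[cite: ChenZhu2014, §3 (first paragraph of the proof of Thm. 1.1)] -/
theorem hasPositiveIsotropicCurvature_of_conformal_sq
    (G : PseudoRiemannianMetric (𝓡 4) ∞ (EuclideanSpace ℝ (Fin 4)) (TangentSpace (𝓡 4) : M → Type _))
    (hG : G.IsRiemannian) [G.HasLeviCivita] {u : M → ℝ} (hu : ContMDiff (𝓡 4) 𝓘(ℝ) ∞ u)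
    (hpos : ∀ x, 0 < u x)
    (hineq : ∀ x, 2 * G.dalembertian u x < u x * minIsotropicCurvature G x)
    (G' : PseudoRiemannianMetric (𝓡 4) ∞ (EuclideanSpace ℝ (Fin 4)) (TangentSpace (𝓡 4) : M → Type _))
    (hval : ∀ (x : M) (v w : TangentSpace (𝓡 4) x), G'.val x v w = u x ^ 2 * G.val x v w) :
    G'.HasPositiveIsotropicCurvature := by
  haveI : G'.HasLeviCivita := G'.hasLeviCivita
  have hE : finrank ℝ (EuclideanSpace ℝ (Fin 4)) = 4 := finrank_euclideanSpace_fin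
  intro cov hcov x e' he'
  -- the conformal law on the `G'`-orthonormal frame `e'`, for the Levi-Civita connection `cov`
  have key := PseudoRiemannianMetric.isotropicCurvature_conformal_sq_four_of_isOrthonormalFrame hE
    G G' hu hpos hval hcov x he'
  -- the `G`-orthonormal frame `u • e'` and the minimal isotropic curvature
  have he : G.IsOrthonormalFrame x (fun i ↦ u x • e' i) :=
    PseudoRiemannianMetric.IsOrthonormalFrame.smul_of_conformal G (hval x) he'
  have hmin := minIsotropicCurvature_le hG he
  have hux := hpos x
  have h3 : 0 < u x ^ 3 := pow_pos hux 3
  have hpos' : 0 < u x * G.isotropicCurvature G.leviCivita x (fun i ↦ u x • e' i)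
      - 2 * G.dalembertian u x := by
    nlinarith [hineq x, mul_le_mul_of_nonneg_left hmin hux.le]
  have hrw : (u x ^ 2)⁻¹ * G.isotropicCurvature G.leviCivita x (fun i ↦ u x • e' i)
        - 2 * (u x ^ 3)⁻¹ * G.dalembertian u x =
      (u x ^ 3)⁻¹ * (u x * G.isotropicCurvature G.leviCivita x (fun i ↦ u x • e' i)
        - 2 * G.dalembertian u x) := by
    field_simp
  rw [key, hrw]
  exact mul_pos (inv_pos.2 h3) hpos'

/-- **Existence form**: under the hypotheses of `hasPositiveIsotropicCurvature_of_conformal_sq`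
there is a smooth Riemannian metric `G' = u² G` of positive isotropic curvature
(`exists_conformal_sq_metric`). [cite: ChenZhu2014, §3 (first paragraph of the proof of Thm. 1.1)] -/
theorem exists_conformal_sq_hasPositiveIsotropicCurvature
    (G : PseudoRiemannianMetric (𝓡 4) ∞ (EuclideanSpace ℝ (Fin 4)) (TangentSpace (𝓡 4) : M → Type _))
    (hG : G.IsRiemannian) [G.HasLeviCivita] {u : M → ℝ} (hu : ContMDiff (𝓡 4) 𝓘(ℝ) ∞ u)
    (hpos : ∀ x, 0 < u x)
    (hineq : ∀ x, 2 * G.dalembertian u x < u x * minIsotropicCurvature G x) :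
    ∃ G' : PseudoRiemannianMetric (𝓡 4) ∞ (EuclideanSpace ℝ (Fin 4)) (TangentSpace (𝓡 4) : M → Type _),
      (∀ (x : M) (v w : TangentSpace (𝓡 4) x), G'.val x v w = u x ^ 2 * G.val x v w) ∧
        G'.IsRiemannian ∧ G'.HasPositiveIsotropicCurvature := by
  obtain ⟨G', hval, hR⟩ := exists_conformal_sq_metric G hG hu hpos
  exact ⟨G', hval, hR, hasPositiveIsotropicCurvature_of_conformal_sq G hG hu hpos hineq G' hval⟩

end Assembly


end Geometry

section WeakSolutions

open UniformSpace InnerProductSpace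
open scoped ENNReal RealInnerProductSpace


/-! ### `L⁴` norms and Hölder pairings -/

section LpFour

variable {X : Type*} [MeasurableSpace X] {μ : Measure X}

/-- The norm of `F ∈ L⁴(μ)` is `(∫ |F|⁴ dμ)^{1/4}`. [folklore] -/
theorem norm_Lp_four_eq (F : Lp ℝ 4 μ) : ‖F‖ = (∫ x, |F x| ^ 4 ∂μ) ^ (1 / 4 : ℝ) := by
  rw [Lp.norm_def, (Lp.memLp F).eLpNorm_eq_integral_rpow_norm (by norm_num) (by norm_num),
    ENNReal.toReal_ofReal (by positivity)]
  have h4 : ((4 : ℝ≥0∞)).toReal = 4 := by norm_num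
  simp only [h4, Real.norm_eq_abs, one_div]
  congr 1
  refine integral_congr_ae (Eventually.of_forall fun x ↦ ?_)
  simp only
  rw [show (4 : ℝ) = ((4 : ℕ) : ℝ) by norm_num, Real.rpow_natCast]

/-- **Hölder, exponents `(4/3, 4)`**: `∫ |ψ| |F| ≤ (∫ |ψ|^{4/3})^{3/4} (∫ |F|⁴)^{1/4}`. [folklore] -/
theorem integral_abs_mul_abs_le_holder_four {ψ F : X → ℝ}
    (hψ : MemLp (fun x ↦ |ψ x|) (ENNReal.ofReal (4 / 3)) μ)
    (hF : MemLp (fun x ↦ |F x|) (ENNReal.ofReal 4) μ) :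
    ∫ x, |ψ x| * |F x| ∂μ ≤
      (∫ x, |ψ x| ^ (4 / 3 : ℝ) ∂μ) ^ (3 / 4 : ℝ) * (∫ x, |F x| ^ 4 ∂μ) ^ (1 / 4 : ℝ) := by
  have hpq : (4 / 3 : ℝ).HolderConjugate 4 := Real.holderConjugate_iff.2 ⟨by norm_num, by norm_num⟩
  have h := integral_mul_le_Lp_mul_Lq_of_nonneg hpq (Eventually.of_forall fun x ↦ abs_nonneg _)
    (Eventually.of_forall fun x ↦ abs_nonneg (F x)) hψ hF
  have hF4 : ∀ x, |F x| ^ (4 : ℝ) = |F x| ^ 4 := fun x ↦ by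
    rw [show (4 : ℝ) = ((4 : ℕ) : ℝ) by norm_num, Real.rpow_natCast]
  have h43 : (1 / (4 / 3) : ℝ) = 3 / 4 := by norm_num
  rw [h43, integral_congr_ae (Eventually.of_forall hF4)] at h
  exact h

/-- The Hölder triple `(4/3, 4, 1)`. [folklore] -/
theorem holderTriple_four_thirds_four : ENNReal.HolderTriple (4 / 3 : ℝ≥0∞) 4 1 := by
  refine ⟨?_⟩
  rw [inv_one, ENNReal.inv_div (Or.inl (by norm_num)) (Or.inl (by norm_num)),
    show (4 : ℝ≥0∞)⁻¹ = 1 / 4 from (one_div (4 : ℝ≥0∞)).symm, ENNReal.div_add_div_same,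
    show (3 : ℝ≥0∞) + 1 = 4 by norm_num]
  exact ENNReal.div_self (by norm_num) (by simp)

/-- `ψ F` is integrable for `ψ ∈ L^{4/3}`, `F ∈ L⁴`. [folklore] -/
theorem integrable_mul_of_memLp_four {ψ F : X → ℝ} (hψ : MemLp ψ (4 / 3 : ℝ≥0∞) μ)
    (hF : MemLp F 4 μ) : Integrable (fun x ↦ ψ x * F x) μ := by
  haveI := holderTriple_four_thirds_four
  exact memLp_one_iff_integrable.1 (MemLp.mul' hF hψ)

variable [TopologicalSpace X] [OpensMeasurableSpace X] [CompactSpace X] [IsFiniteMeasure μ]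

/-- A continuous function on a compact space is in every `Lᵖ` of a finite measure. [folklore] -/
theorem memLp_of_continuous' {F : X → ℝ} (hF : Continuous F) (p : ℝ≥0∞) : MemLp F p μ :=
  ⟨hF.aestronglyMeasurable, eLpNorm_lt_top_of_continuous hF p⟩

/-- For a continuous `φ` on a compact space, the `L⁴` class of `φ` has norm `(∫ |φ|⁴)^{1/4}`.
[folklore] -/
theorem norm_toLp_four_eq {φ : X → ℝ} (hφ : Continuous φ) :
    ‖(memLp_of_continuous' (μ := μ) hφ 4).toLp φ‖ = (∫ x, |φ x| ^ 4 ∂μ) ^ (1 / 4 : ℝ) := by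
  rw [norm_Lp_four_eq]
  congr 1
  refine integral_congr_ae ?_
  filter_upwards [(memLp_of_continuous' (μ := μ) hφ 4).coeFn_toLp] with x hx
  rw [hx]

/-- **Weak-star continuity of the pairing with continuous functions**: if `Fₙ → U` in `L⁴(μ)` on
a compact space with finite measure and `ψ` is continuous, then `∫ ψ Fₙ → ∫ ψ U` (Hölder).
[folklore] -/
theorem tendsto_integral_mul_of_tendsto_Lp_four [Fact (1 ≤ (4 : ℝ≥0∞))] {Fn : ℕ → Lp ℝ 4 μ}
    {U : Lp ℝ 4 μ} (hFU : Tendsto Fn atTop (𝓝 U)) {ψ : X → ℝ} (hψ : Continuous ψ) :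
    Tendsto (fun n ↦ ∫ x, ψ x * Fn n x ∂μ) atTop (𝓝 (∫ x, ψ x * U x ∂μ)) := by
  have hψ43 : MemLp ψ (4 / 3 : ℝ≥0∞) μ := memLp_of_continuous' hψ _
  have hψa : MemLp (fun x ↦ |ψ x|) (ENNReal.ofReal (4 / 3)) μ := memLp_of_continuous' hψ.abs _
  set C : ℝ := (∫ x, |ψ x| ^ (4 / 3 : ℝ) ∂μ) ^ (3 / 4 : ℝ) with hC
  have hC0 : 0 ≤ C := by positivity
  rw [Metric.tendsto_atTop] at hFU ⊢
  intro ε hε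
  obtain ⟨N, hN⟩ := hFU (ε / (C + 1)) (div_pos hε (by positivity))
  refine ⟨N, fun n hn ↦ ?_⟩
  have hdist := hN n hn
  rw [dist_eq_norm] at hdist
  have hiF : Integrable (fun x ↦ ψ x * Fn n x) μ := integrable_mul_of_memLp_four hψ43 (Lp.memLp _)
  have hiU : Integrable (fun x ↦ ψ x * U x) μ := integrable_mul_of_memLp_four hψ43 (Lp.memLp _)
  have hsub : ∫ x, ψ x * Fn n x ∂μ - ∫ x, ψ x * U x ∂μ = ∫ x, ψ x * (Fn n - U) x ∂μ := by
    rw [← integral_sub hiF hiU]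
    refine integral_congr_ae ?_
    filter_upwards [Lp.coeFn_sub (Fn n) U] with x hx
    rw [hx, Pi.sub_apply, mul_sub]
  rw [Real.dist_eq, hsub]
  have hH : MemLp (fun x ↦ |(Fn n - U) x|) (ENNReal.ofReal 4) μ := by
    rw [show ENNReal.ofReal 4 = 4 by norm_num]
    exact (Lp.memLp _).abs
  calc |∫ x, ψ x * (Fn n - U) x ∂μ| ≤ ∫ x, |ψ x * (Fn n - U) x| ∂μ := abs_integral_le_integral_abs
    _ = ∫ x, |ψ x| * |(Fn n - U) x| ∂μ := by simp only [abs_mul]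
    _ ≤ C * (∫ x, |(Fn n - U) x| ^ 4 ∂μ) ^ (1 / 4 : ℝ) := integral_abs_mul_abs_le_holder_four hψa hH
    _ = C * ‖Fn n - U‖ := by rw [norm_Lp_four_eq]
    _ ≤ C * (ε / (C + 1)) := mul_le_mul_of_nonneg_left hdist.le hC0
    _ < ε := by
        rw [mul_div_assoc', div_lt_iff₀ (by positivity)]
        nlinarith

/-- **The pairing with a continuous function is `L⁴`-bounded**: `|∫ g ζ| ≤ ‖g‖_{4/3} (∫|ζ|⁴)^{1/4}`.
[folklore] -/
theorem abs_integral_mul_le_of_continuous {g ζ : X → ℝ} (hg : Continuous g) (hζ : Continuous ζ) :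
    |∫ x, g x * ζ x ∂μ| ≤
      (∫ x, |g x| ^ (4 / 3 : ℝ) ∂μ) ^ (3 / 4 : ℝ) * (∫ x, |ζ x| ^ 4 ∂μ) ^ (1 / 4 : ℝ) := by
  have hga : MemLp (fun x ↦ |g x|) (ENNReal.ofReal (4 / 3)) μ := memLp_of_continuous' hg.abs _
  have hζa : MemLp (fun x ↦ |ζ x|) (ENNReal.ofReal 4) μ := memLp_of_continuous' hζ.abs _
  calc |∫ x, g x * ζ x ∂μ| ≤ ∫ x, |g x * ζ x| ∂μ := abs_integral_le_integral_abs
    _ = ∫ x, |g x| * |ζ x| ∂μ := by simp only [abs_mul]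
    _ ≤ _ := integral_abs_mul_abs_le_holder_four hga hζa

end LpFour

/-! ### Weak existence for `Δ_h u − f u = g` from coercivity of the form on smooth functions -/

section WeakExistence

variable {m : ℕ} {N : Type*} [TopologicalSpace N] [ChartedSpace (EuclideanSpace ℝ (Fin m)) N]
  [IsManifold (𝓡 m) ∞ N] [CompactSpace N] [T2Space N] [MeasurableSpace N] [BorelSpace N]
  (h : ContMDiffRiemannianMetric (𝓡 m) ∞ (EuclideanSpace ℝ (Fin m)) (TangentSpace (𝓡 m) : N → Type _))
  [(ofRiemannian h).HasLeviCivita]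

omit [IsManifold (𝓡 m) ∞ N] [CompactSpace N] [T2Space N] [MeasurableSpace N] [BorelSpace N]
  [(ofRiemannian h).HasLeviCivita] in
/-- `d(c u) = c du` for the vector-valued manifold derivative of a real function. [folklore] -/
theorem mvfderiv_const_smul'' (x : N) {u : N → ℝ} (hu : MDifferentiableAt (𝓡 m) 𝓘(ℝ, ℝ) u x)
    (c : ℝ) : mvfderiv (𝓡 m) (c • u) x = c • mvfderiv (𝓡 m) u x := by
  ext v
  simp [mvfderiv, const_smul_mfderiv hu c]
  rfl

/-- **Weak existence from coercivity on smooth functions** (closed manifolds). Let `(N, h)` be a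
closed Riemannian manifold, `f, g` continuous, and suppose the quadratic form
`B(φ, φ) = ∫ (h⁻¹(dφ, dφ) + f φ²) dμ_h` is coercive on `C^∞(N)` in the sense
`c (∫ φ⁴ dμ_h)^{1/2} ≤ B(φ, φ)` for all smooth `φ`, for some `c > 0` (a positive "Yamabe-type"
lower bound; on a closed `4`-manifold this is positivity of the bottom of the spectrum of
`−Δ_h + f` via the Sobolev inequality). Then there is `u ∈ L⁴(N, dμ_h)` solving `Δ_h u − f u = g`
in the sense of distributions against smooth test functions:
`∫ u (Δ_h ζ − f ζ) dμ_h = ∫ g ζ dμ_h` for every `ζ ∈ C^∞(N)`.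

*Proof* (the energy method of Schoen–Yau 1979, proof of Lemma 3.2, in the form of
`exists_veryWeakSolution_of_sobolev`, with the Dirichlet inner product replaced by `B` itself):
`B` is a genuine inner product on `C^∞(N)` (definiteness by coercivity and positivity of `μ_h` on
open sets), the functional `ℓ(ψ) = −∫ g ψ dμ_h` is bounded (`|∫gψ| ≤ ‖g‖_{4/3}‖ψ‖₄ ≤ C‖ψ‖_B`,
Hölder and coercivity), so by the Riesz–Lax–Milgram theorem on the completion
(`exists_cauchySeq_tendsto_of_coercive`) there is a `B`-Cauchy sequence `vₙ ∈ C^∞(N)` with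
`B(vₙ, ζ) → ℓ(ζ)`; by coercivity `(vₙ)` is Cauchy in `L⁴` with limit `u`, and Green's identity
`∫ h⁻¹(dvₙ, dζ) = −∫ vₙ Δ_h ζ` (`integral_mul_dalembertian_eq_neg_integral_innerDual`) turns
`B(vₙ, ζ) = ∫ vₙ (fζ − Δ_hζ) → ∫ u (fζ − Δ_hζ)` into the asserted identity.
[cite: SchoenYauPMT1979, Lemma 3.2 (p. 64) and its proof (p. 65)]
[cite: GilbargTrudinger2001, Thm. 5.8] -/
theorem exists_veryWeakSolution_of_coercive {c : ℝ} (hc : 0 < c) {f g : N → ℝ}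
    (hf : Continuous f) (hg : Continuous g)
    (hcoer : ∀ φ : N → ℝ, ContMDiff (𝓡 m) 𝓘(ℝ, ℝ) ∞ φ →
      c * Real.sqrt (∫ x, φ x ^ 4 ∂riemannianMeasure h) ≤
        ∫ x, ((ofRiemannian h).innerDual x (mvfderiv (𝓡 m) φ x).toLinearMap
          (mvfderiv (𝓡 m) φ x).toLinearMap + f x * φ x ^ 2) ∂riemannianMeasure h) :
    ∃ u : N → ℝ, MemLp u 4 (riemannianMeasure h) ∧
      ∀ ζ : N → ℝ, ContMDiff (𝓡 m) 𝓘(ℝ, ℝ) ∞ ζ →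
        ∫ x, u x * ((ofRiemannian h).dalembertian ζ x - f x * ζ x) ∂riemannianMeasure h =
          ∫ x, g x * ζ x ∂riemannianMeasure h := by
  classical
  haveI hFact : Fact (1 ≤ (4 : ℝ≥0∞)) := ⟨by norm_num⟩
  set μ : Measure N := riemannianMeasure h with hμ
  haveI : IsFiniteMeasure μ := isFiniteMeasure_riemannianMeasure h
  haveI : μ.IsOpenPosMeasure := isOpenPosMeasure_riemannianMeasure h
  /- the form `P u w = ∫ (h⁻¹(du, dw) + f u w) dμ` -/
  obtain ⟨P, hP⟩ : ∃ P : (N → ℝ) → (N → ℝ) → ℝ, ∀ u w, P u w =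
      ∫ x, ((ofRiemannian h).innerDual x (mvfderiv (𝓡 m) u x).toLinearMap
        (mvfderiv (𝓡 m) w x).toLinearMap + f x * u x * w x) ∂μ := ⟨_, fun _ _ ↦ rfl⟩
  have hcont : ∀ {u w : N → ℝ}, ContMDiff (𝓡 m) 𝓘(ℝ, ℝ) ∞ u → ContMDiff (𝓡 m) 𝓘(ℝ, ℝ) ∞ w →
      Continuous fun x ↦ (ofRiemannian h).innerDual x (mvfderiv (𝓡 m) u x).toLinearMap
        (mvfderiv (𝓡 m) w x).toLinearMap + f x * u x * w x := by
    intro u w hu hw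
    exact (continuous_innerDual_mvfderiv (ofRiemannian h) (hu.of_le (by exact_mod_cast le_top))
      (hw.of_le (by exact_mod_cast le_top))).add ((hf.mul hu.continuous).mul hw.continuous)
  have hPint : ∀ {u w : N → ℝ}, ContMDiff (𝓡 m) 𝓘(ℝ, ℝ) ∞ u → ContMDiff (𝓡 m) 𝓘(ℝ, ℝ) ∞ w →
      Integrable (fun x ↦ (ofRiemannian h).innerDual x (mvfderiv (𝓡 m) u x).toLinearMap
        (mvfderiv (𝓡 m) w x).toLinearMap + f x * u x * w x) μ :=
    fun hu hw ↦ integrable_of_continuous h (hcont hu hw)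
  have hPcomm : ∀ u w, P u w = P w u := fun u w ↦ by
    rw [hP, hP]
    refine integral_congr_ae (Eventually.of_forall fun x ↦ ?_)
    simp only
    rw [(ofRiemannian h).innerDual_comm x]
    ring
  have hPadd : ∀ {u v w : N → ℝ}, ContMDiff (𝓡 m) 𝓘(ℝ, ℝ) ∞ u → ContMDiff (𝓡 m) 𝓘(ℝ, ℝ) ∞ v →
      ContMDiff (𝓡 m) 𝓘(ℝ, ℝ) ∞ w → P (u + v) w = P u w + P v w := by
    intro u v w hu hv hw
    rw [hP, hP, hP, ← integral_add (hPint hu hw) (hPint hv hw)]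
    refine integral_congr_ae (Eventually.of_forall fun x ↦ ?_)
    simp only [Pi.add_apply]
    rw [mvfderiv_add ((hu x).mdifferentiableAt (by simp)) ((hv x).mdifferentiableAt (by simp))]
    simp only [ContinuousLinearMap.toLinearMap_add, PseudoRiemannianMetric.innerDual,
      LinearMap.add_apply]
    ring
  have hPsmul : ∀ {u w : N → ℝ} (a : ℝ), ContMDiff (𝓡 m) 𝓘(ℝ, ℝ) ∞ u →
      P (a • u) w = a * P u w := by
    intro u w a hu
    rw [hP, hP, ← integral_const_mul]
    refine integral_congr_ae (Eventually.of_forall fun x ↦ ?_)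
    simp only [Pi.smul_apply, smul_eq_mul]
    rw [mvfderiv_const_smul'' x ((hu x).mdifferentiableAt (by simp)) a]
    simp only [ContinuousLinearMap.toLinearMap_smul, PseudoRiemannianMetric.innerDual,
      LinearMap.smul_apply, smul_eq_mul]
    ring
  have hPself : ∀ {u : N → ℝ}, ContMDiff (𝓡 m) 𝓘(ℝ, ℝ) ∞ u →
      P u u = ∫ x, ((ofRiemannian h).innerDual x (mvfderiv (𝓡 m) u x).toLinearMap
        (mvfderiv (𝓡 m) u x).toLinearMap + f x * u x ^ 2) ∂μ := by
    intro u hu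
    rw [hP]
    refine integral_congr_ae (Eventually.of_forall fun x ↦ ?_)
    simp only
    ring
  have hPcoer : ∀ {u : N → ℝ}, ContMDiff (𝓡 m) 𝓘(ℝ, ℝ) ∞ u →
      c * Real.sqrt (∫ x, u x ^ 4 ∂μ) ≤ P u u := fun hu ↦ by rw [hPself hu]; exact hcoer _ hu
  have hPnonneg : ∀ {u : N → ℝ}, ContMDiff (𝓡 m) 𝓘(ℝ, ℝ) ∞ u → 0 ≤ P u u := fun hu ↦
    (mul_nonneg hc.le (Real.sqrt_nonneg _)).trans (hPcoer hu)
  /- the test space `W = C^∞(N)` as a submodule of `C^∞(N)` (no topology on the carrier) -/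
  obtain ⟨W, hW⟩ : ∃ W : Submodule ℝ (ContMDiffMap (𝓡 m) 𝓘(ℝ, ℝ) N ℝ ∞),
      ∀ φ : ContMDiffMap (𝓡 m) 𝓘(ℝ, ℝ) N ℝ ∞, φ ∈ W := ⟨⊤, fun _ ↦ Submodule.mem_top⟩
  obtain ⟨ev, hev⟩ : ∃ ev : W → N → ℝ, ∀ φ, ev φ = ⇑(φ : ContMDiffMap (𝓡 m) 𝓘(ℝ, ℝ) N ℝ ∞) :=
    ⟨_, fun _ ↦ rfl⟩
  have hevs : ∀ φ : W, ContMDiff (𝓡 m) 𝓘(ℝ, ℝ) ∞ (ev φ) := fun φ ↦ by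
    rw [hev]; exact (φ : ContMDiffMap (𝓡 m) 𝓘(ℝ, ℝ) N ℝ ∞).contMDiff
  have hev1 : ∀ φ : W, ContMDiff (𝓡 m) 𝓘(ℝ, ℝ) 1 (ev φ) := fun φ ↦
    (hevs φ).of_le (by exact_mod_cast le_top)
  have hevcont : ∀ φ : W, Continuous (ev φ) := fun φ ↦ (hevs φ).continuous
  have hev_add : ∀ φ ψ : W, ev (φ + ψ) = ev φ + ev ψ := fun φ ψ ↦ by rw [hev, hev, hev]; rfl
  have hev_smul : ∀ (a : ℝ) (φ : W), ev (a • φ) = a • ev φ := fun a φ ↦ by rw [hev, hev]; rfl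
  have hev_sub : ∀ φ ψ : W, ev (φ - ψ) = ev φ - ev ψ := fun φ ψ ↦ by rw [hev, hev, hev]; rfl
  have hev_zero : ev 0 = 0 := by rw [hev]; rfl
  have hev_inj : ∀ φ ψ : W, ev φ = ev ψ → φ = ψ := fun φ ψ h ↦ by
    rw [hev, hev] at h
    exact Subtype.ext (DFunLike.coe_injective h)
  have hev_mk : ∀ ζ : N → ℝ, ContMDiff (𝓡 m) 𝓘(ℝ, ℝ) ∞ ζ → ∃ φ : W, ev φ = ζ := fun ζ hζ ↦
    ⟨⟨⟨ζ, hζ⟩, hW _⟩, by rw [hev]; rfl⟩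
  /- the inner product `B` on `W` -/
  have hip_add : ∀ φ ψ χ : W, P (ev (φ + ψ)) (ev χ) = P (ev φ) (ev χ) + P (ev ψ) (ev χ) :=
    fun φ ψ χ ↦ by rw [hev_add]; exact hPadd (hevs φ) (hevs ψ) (hevs χ)
  have hip_smul : ∀ (a : ℝ) (φ χ : W), P (ev (a • φ)) (ev χ) = a * P (ev φ) (ev χ) :=
    fun a φ χ ↦ by rw [hev_smul]; exact hPsmul a (hevs φ)
  have hip_def : ∀ φ : W, P (ev φ) (ev φ) = 0 → φ = 0 := by
    intro φ h0
    have h4 : c * Real.sqrt (∫ x, ev φ x ^ 4 ∂μ) ≤ 0 := by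
      have := hPcoer (hevs φ); rwa [h0] at this
    have hI0 : 0 ≤ ∫ x, ev φ x ^ 4 ∂μ := integral_nonneg fun x ↦ by positivity
    have hsqrt : Real.sqrt (∫ x, ev φ x ^ 4 ∂μ) = 0 :=
      le_antisymm (nonpos_of_mul_nonpos_right (by linarith) hc |>.trans le_rfl) (Real.sqrt_nonneg _)
    have hI : ∫ x, ev φ x ^ 4 ∂μ = 0 := by
      rwa [Real.sqrt_eq_zero hI0] at hsqrt
    have hint : Integrable (fun x ↦ ev φ x ^ 4) μ := integrable_of_continuous h ((hevcont φ).pow 4)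
    have hae := (integral_eq_zero_iff_of_nonneg (fun x ↦ by positivity) hint).1 hI
    have hfun : (fun x ↦ ev φ x ^ 4) = fun _ ↦ (0 : ℝ) :=
      (Continuous.ae_eq_iff_eq μ ((hevcont φ).pow 4) continuous_const).1 hae
    apply hev_inj
    rw [hev_zero]
    funext x
    have hx := congr_fun hfun x
    have hx0 : ev φ x = 0 := by
      have h6 : ev φ x ^ 4 = 0 := hx
      exact (pow_eq_zero_iff (by norm_num)).1 h6
    simpa using hx0
  obtain ⟨core, hcore⟩ : ∃ core : InnerProductSpace.Core ℝ W,
      ∀ φ ψ, core.inner φ ψ = P (ev φ) (ev ψ) :=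
    ⟨{ inner := fun φ ψ ↦ P (ev φ) (ev ψ)
       conj_inner_symm := fun φ ψ ↦ by simp [hPcomm (ev φ) (ev ψ)]
       re_inner_nonneg := fun φ ↦ by simpa using hPnonneg (hevs φ)
       add_left := hip_add
       smul_left := fun φ ψ r ↦ by simpa using hip_smul r φ ψ
       definite := hip_def }, fun _ _ ↦ rfl⟩
  letI i1 : NormedAddCommGroup W := @InnerProductSpace.Core.toNormedAddCommGroup ℝ W _ _ _ core
  letI i2 : InnerProductSpace ℝ W := InnerProductSpace.ofCore core.toCore
  have hinner : ∀ φ ψ : W, ⟪φ, ψ⟫ = P (ev φ) (ev ψ) := fun φ ψ ↦ hcore φ ψ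
  have hnormsq : ∀ φ : W, ‖φ‖ ^ 2 = P (ev φ) (ev φ) := fun φ ↦ by
    rw [← real_inner_self_eq_norm_sq, hinner]
  -- coercivity in `L⁴`: `(∫ φ⁴)^{1/4} ≤ ‖φ‖ / √c`
  have hL4 : ∀ φ : W, (∫ x, |ev φ x| ^ 4 ∂μ) ^ (1 / 4 : ℝ) ≤ (Real.sqrt c)⁻¹ * ‖φ‖ := by
    intro φ
    have h1 := hPcoer (hevs φ)
    rw [← hnormsq] at h1
    have habs : ∫ x, |ev φ x| ^ 4 ∂μ = ∫ x, ev φ x ^ 4 ∂μ :=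
      integral_congr_ae (Eventually.of_forall fun x ↦ by
        show |ev φ x| ^ 4 = ev φ x ^ 4
        rw [pow_abs, abs_of_nonneg (by positivity)])
    have hI0 : 0 ≤ ∫ x, ev φ x ^ 4 ∂μ := integral_nonneg fun x ↦ by positivity
    have hsc : 0 < Real.sqrt c := Real.sqrt_pos.2 hc
    have h14 : (∫ x, ev φ x ^ 4 ∂μ) ^ (1 / 4 : ℝ) = Real.sqrt (Real.sqrt (∫ x, ev φ x ^ 4 ∂μ)) := by
      rw [Real.sqrt_eq_rpow, Real.sqrt_eq_rpow, ← Real.rpow_mul hI0]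
      norm_num
    rw [habs, h14]
    have h2 : Real.sqrt (∫ x, ev φ x ^ 4 ∂μ) ≤ ‖φ‖ ^ 2 / c := by
      rw [le_div_iff₀ hc]; linarith
    calc Real.sqrt (Real.sqrt (∫ x, ev φ x ^ 4 ∂μ)) ≤ Real.sqrt (‖φ‖ ^ 2 / c) := Real.sqrt_le_sqrt h2
      _ = (Real.sqrt c)⁻¹ * ‖φ‖ := by
          rw [Real.sqrt_div (sq_nonneg _), Real.sqrt_sq (norm_nonneg _)]
          ring
  /- the bilinear form `B₀ = ⟪·, ·⟫` and the functional `ℓ₀ ψ = −∫ g ψ` -/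
  have hBex : ∃ B₀ : W →L[ℝ] W →L[ℝ] ℝ, ∀ φ ψ, B₀ φ ψ = ⟪φ, ψ⟫ := by
    refine ⟨LinearMap.mkContinuous₂
      (LinearMap.mk₂ ℝ (fun φ ψ ↦ ⟪φ, ψ⟫) ?_ ?_ ?_ ?_) 1 ?_, fun φ ψ ↦ rfl⟩
    · intro φ ψ χ; rw [inner_add_left]
    · intro a φ χ; rw [real_inner_smul_left]; rfl
    · intro φ ψ χ; rw [inner_add_right]
    · intro a φ χ; rw [real_inner_smul_right]; rfl
    · intro φ ψ
      simp only [LinearMap.mk₂_apply, Real.norm_eq_abs, one_mul]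
      exact abs_real_inner_le_norm φ ψ
  obtain ⟨B₀, hB₀⟩ := hBex
  set Cg : ℝ := (∫ x, |g x| ^ (4 / 3 : ℝ) ∂μ) ^ (3 / 4 : ℝ) with hCg
  have hCg0 : 0 ≤ Cg := by positivity
  have hℓ_int : ∀ ψ : W, Integrable (fun x ↦ g x * ev ψ x) μ := fun ψ ↦
    integrable_of_continuous h (hg.mul (hevcont ψ))
  have hℓ_bound : ∀ ψ : W, |∫ x, g x * ev ψ x ∂μ| ≤ Cg * (Real.sqrt c)⁻¹ * ‖ψ‖ := by
    intro ψ
    calc |∫ x, g x * ev ψ x ∂μ| ≤ Cg * (∫ x, |ev ψ x| ^ 4 ∂μ) ^ (1 / 4 : ℝ) :=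
          abs_integral_mul_le_of_continuous hg (hevcont ψ)
      _ ≤ Cg * ((Real.sqrt c)⁻¹ * ‖ψ‖) := mul_le_mul_of_nonneg_left (hL4 ψ) hCg0
      _ = Cg * (Real.sqrt c)⁻¹ * ‖ψ‖ := by ring
  have hℓex : ∃ ℓ₀ : W →L[ℝ] ℝ, ∀ ψ, ℓ₀ ψ = -∫ x, g x * ev ψ x ∂μ := by
    refine ⟨LinearMap.mkContinuous
      { toFun := fun ψ ↦ -∫ x, g x * ev ψ x ∂μ
        map_add' := ?_
        map_smul' := ?_ } (Cg * (Real.sqrt c)⁻¹) ?_, fun ψ ↦ rfl⟩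
    · intro φ ψ
      rw [hev_add, ← neg_add, ← integral_add (hℓ_int φ) (hℓ_int ψ)]
      congr 1
      refine integral_congr_ae (Eventually.of_forall fun x ↦ ?_)
      simp only [Pi.add_apply]; ring
    · intro a ψ
      simp only [RingHom.id_apply, smul_eq_mul]
      rw [hev_smul, mul_neg, ← integral_const_mul]
      congr 1
      refine integral_congr_ae (Eventually.of_forall fun x ↦ ?_)
      simp only [Pi.smul_apply, smul_eq_mul]; ring
    · intro ψ
      simp only [LinearMap.coe_mk, AddHom.coe_mk, Real.norm_eq_abs, abs_neg]
      exact hℓ_bound ψ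
  obtain ⟨ℓ₀, hℓ₀⟩ := hℓex
  /- coercivity of `B₀` with constant `1` and the Lax–Milgram sequence -/
  have hcoer1 : ∀ φ : W, 1 * ‖φ‖ ^ 2 ≤ B₀ φ φ := fun φ ↦ by
    rw [hB₀, real_inner_self_eq_norm_sq, one_mul]
  obtain ⟨v, hvC, hvB, -⟩ := exists_cauchySeq_tendsto_of_coercive B₀ ℓ₀ one_pos hcoer1
  /- passage to `L⁴` -/
  have hmem : ∀ φ : W, MemLp (ev φ) 4 μ := fun φ ↦ memLp_of_continuous' (hevcont φ) 4
  obtain ⟨T, hT⟩ : ∃ T : W → Lp ℝ 4 μ, ∀ φ, T φ = (hmem φ).toLp (ev φ) := ⟨_, fun _ ↦ rfl⟩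
  have hTsub : ∀ φ ψ : W, T φ - T ψ = T (φ - ψ) := by
    intro φ ψ
    rw [hT, hT, hT, ← MemLp.toLp_sub (hmem φ) (hmem ψ)]
    exact MemLp.toLp_congr _ _ (by rw [hev_sub])
  have hTnorm : ∀ φ : W, ‖T φ‖ = (∫ x, |ev φ x| ^ 4 ∂μ) ^ (1 / 4 : ℝ) := fun φ ↦ by
    rw [hT]; exact norm_toLp_four_eq (hevcont φ)
  have hTle : ∀ φ : W, ‖T φ‖ ≤ (Real.sqrt c)⁻¹ * ‖φ‖ := fun φ ↦ by rw [hTnorm]; exact hL4 φ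
  have hsc0 : 0 ≤ (Real.sqrt c)⁻¹ := inv_nonneg.2 (Real.sqrt_nonneg _)
  have hTC : CauchySeq fun n ↦ T (v n) := by
    rw [Metric.cauchySeq_iff] at hvC ⊢
    intro ε hε
    obtain ⟨M₀, hM⟩ := hvC (ε / ((Real.sqrt c)⁻¹ + 1)) (by positivity)
    refine ⟨M₀, fun k hk n hn ↦ ?_⟩
    have hmn := hM k hk n hn
    rw [dist_eq_norm] at hmn ⊢
    rw [hTsub]
    calc ‖T (v k - v n)‖ ≤ (Real.sqrt c)⁻¹ * ‖v k - v n‖ := hTle _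
      _ ≤ (Real.sqrt c)⁻¹ * (ε / ((Real.sqrt c)⁻¹ + 1)) := mul_le_mul_of_nonneg_left hmn.le hsc0
      _ < ε := by
          rw [mul_div_assoc', div_lt_iff₀ (by positivity)]
          nlinarith
  obtain ⟨U, hU⟩ := cauchySeq_tendsto_of_complete hTC
  refine ⟨U, Lp.memLp U, ?_⟩
  /- the distributional identity -/
  intro ζ hζ
  obtain ⟨φζ, hφζ⟩ := hev_mk ζ hζ
  have hζ1 : ContMDiff (𝓡 m) 𝓘(ℝ, ℝ) 1 ζ := hζ.of_le (by exact_mod_cast le_top)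
  have hζ2 : ContMDiff (𝓡 m) 𝓘(ℝ, ℝ) 2 ζ := hζ.of_le (WithTop.coe_le_coe.mpr le_top)
  have hζcont : Continuous ζ := hζ.continuous
  -- the test integrand `ψ = f ζ − Δ_h ζ`
  obtain ⟨ψ, hψ⟩ : ∃ ψ : N → ℝ, ψ = fun x ↦ f x * ζ x - (ofRiemannian h).dalembertian ζ x :=
    ⟨_, rfl⟩
  have hΔc : Continuous ((ofRiemannian h).dalembertian ζ) := continuous_dalembertian _ hζ2
  have hψc : Continuous ψ := by rw [hψ]; exact (hf.mul hζcont).sub hΔc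
  -- `B₀ (v n) φζ = ∫ ψ · v n`
  have hBψ : ∀ n, B₀ (v n) φζ = ∫ x, ψ x * T (v n) x ∂μ := by
    intro n
    have hGreen : ∫ x, ev (v n) x * (ofRiemannian h).dalembertian ζ x ∂μ =
        -∫ x, (ofRiemannian h).innerDual x (mvfderiv (𝓡 m) (ev (v n)) x).toLinearMap
          (mvfderiv (𝓡 m) ζ x).toLinearMap ∂μ :=
      integral_mul_dalembertian_eq_neg_integral_innerDual h (hev1 (v n)) hζ2
    have hi1 : Integrable (fun x ↦ ev (v n) x * (ofRiemannian h).dalembertian ζ x) μ :=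
      integrable_of_continuous h ((hevcont (v n)).mul hΔc)
    have hi2 : Integrable (fun x ↦ f x * ev (v n) x * ζ x) μ :=
      integrable_of_continuous h ((hf.mul (hevcont (v n))).mul hζcont)
    have hi3 : Integrable (fun x ↦ (ofRiemannian h).innerDual x
        (mvfderiv (𝓡 m) (ev (v n)) x).toLinearMap (mvfderiv (𝓡 m) ζ x).toLinearMap) μ :=
      integrable_of_continuous h (continuous_innerDual_mvfderiv (ofRiemannian h) (hev1 (v n)) hζ1)
    have hae : (fun x ↦ ψ x * T (v n) x) =ᵐ[μ] fun x ↦ ψ x * ev (v n) x := by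
      filter_upwards [show (T (v n) : N → ℝ) =ᵐ[μ] ev (v n) from by
        rw [hT]; exact (hmem (v n)).coeFn_toLp] with x hx
      rw [hx]
    rw [integral_congr_ae hae, hB₀, hinner, hP, hφζ, integral_add hi3 hi2]
    rw [show (∫ x, (ofRiemannian h).innerDual x (mvfderiv (𝓡 m) (ev (v n)) x).toLinearMap
        (mvfderiv (𝓡 m) ζ x).toLinearMap ∂μ) =
        -∫ x, ev (v n) x * (ofRiemannian h).dalembertian ζ x ∂μ by rw [hGreen, neg_neg]]
    have hi1' : Integrable (fun x ↦ -(ev (v n) x * (ofRiemannian h).dalembertian ζ x)) μ := hi1.neg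
    rw [← integral_neg, ← integral_add hi1' hi2]
    refine integral_congr_ae (Eventually.of_forall fun x ↦ ?_)
    rw [hψ]
    ring
  have hlim1 : Tendsto (fun n ↦ ∫ x, ψ x * T (v n) x ∂μ) atTop (𝓝 (∫ x, ψ x * U x ∂μ)) :=
    tendsto_integral_mul_of_tendsto_Lp_four hU hψc
  have hlim2 : Tendsto (fun n ↦ ∫ x, ψ x * T (v n) x ∂μ) atTop (𝓝 (ℓ₀ φζ)) := by
    have := hvB φζ
    simp_rw [hBψ] at this
    exact this
  have heq : ∫ x, ψ x * U x ∂μ = -∫ x, g x * ζ x ∂μ := by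
    rw [tendsto_nhds_unique hlim1 hlim2, hℓ₀, hφζ]
  calc ∫ x, U x * ((ofRiemannian h).dalembertian ζ x - f x * ζ x) ∂μ
      = ∫ x, -(ψ x * U x) ∂μ := by
        refine integral_congr_ae (Eventually.of_forall fun x ↦ ?_)
        rw [hψ]; ring
    _ = ∫ x, g x * ζ x ∂μ := by rw [integral_neg, heq, neg_neg]

end WeakExistence


end WeakSolutions

section Regularity

open scoped Matrix ENNReal


/-! ### The distributional equation with smooth test functions, read in a chart -/

section ChartIdentity

variable {m : ℕ} {H : Type*} [TopologicalSpace H]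
  {I : ModelWithCorners ℝ (EuclideanSpace ℝ (Fin m)) H} [I.Boundaryless]
  {N : Type*} [TopologicalSpace N] [ChartedSpace H N] [IsManifold I ∞ N]
  [T2Space N] [LocallyCompactSpace N] [MeasurableSpace N] [BorelSpace N]
  (h : ContMDiffRiemannianMetric I ∞ (EuclideanSpace ℝ (Fin m)) (TangentSpace I : N → Type _))
  [(ofRiemannian h).HasLeviCivita]

/-- **The distributional equation `Δ_h u − f u = g` read in a chart.** Let `(N, h)` be a
Riemannian manifold modelled on `ℝ^m`, `u : N → ℝ` measurable, `f, g` continuous, and suppose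
`∫ u (Δ_h ζ − f ζ) dμ_h = ∫ g ζ dμ_h` for all `ζ ∈ C²_c(N)`. Then in the extended chart `φ` at `x`,
with Gram matrix `G(y) = (h_{ij}(y))`, density `√det G` and `aᵢⱼ = √det G · (G⁻¹)ⱼᵢ`, the
representative `ū = u ∘ φ⁻¹` satisfies, for every smooth `ψ` compactly supported in `φ.target`,
`∫ ū (∑ᵢⱼ ∂ⱼ(aᵢⱼ ∂ᵢψ) − √det G (f ∘ φ⁻¹) ψ) dy = ∫ √det G (g ∘ φ⁻¹) ψ dy`
— the divergence form `√g Δ_h ζ ∘ φ⁻¹ = ∑ᵢ ∂ᵢ(√g gⁱˡ ∂ₗ ψ)` of the coordinate Laplacian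
(`coordLaplacian_mul_sqrt_det_eq_sum_fderiv`) applied to the zero extension `ζ` of `ψ ∘ φ`, and the
chart formula `dμ_h = √g dy` (`integral_eq_integral_chart`). Chavel 2006, §III.3 (III.3.6) and
§III.7 (the Laplacian in local coordinates). [cite: Chavel2006, §III.3 (III.3.6)] -/
theorem integral_comp_extChartAt_symm_divForm_of_veryWeak_smooth (x : N) {u : N → ℝ} (hum : Measurable u)
    {f g : N → ℝ} (hf : Continuous f) (hg : Continuous g)
    (hweak : ∀ ζ : N → ℝ, CMDiff ∞ ζ → HasCompactSupport ζ →
      ∫ p, u p * ((ofRiemannian h).dalembertian ζ p - f p * ζ p) ∂riemannianMeasure h =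
        ∫ p, g p * ζ p ∂riemannianMeasure h)
    {ψ : EuclideanSpace ℝ (Fin m) → ℝ} (hψ : ContDiff ℝ ∞ ψ) (hψc : HasCompactSupport ψ)
    (hψT : tsupport ψ ⊆ (extChartAt I x).target) :
    ∫ y, u ((extChartAt I x).symm y) *
        ((∑ i, ∑ j, fderiv ℝ (fun z ↦ (Real.sqrt (chartGramMatrix h x z).det *
            (chartGramMatrix h x z)⁻¹ j i) *
            fderiv ℝ ψ z ((EuclideanSpace.basisFun (Fin m) ℝ).toBasis i)) y
            ((EuclideanSpace.basisFun (Fin m) ℝ).toBasis j)) -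
          (Real.sqrt (chartGramMatrix h x y).det * f ((extChartAt I x).symm y)) * ψ y) =
      ∫ y, (Real.sqrt (chartGramMatrix h x y).det * g ((extChartAt I x).symm y)) * ψ y := by
  classical
  -- notation: the standard basis, the chart target, the Gram matrix
  set b : Module.Basis (Fin m) ℝ (EuclideanSpace ℝ (Fin m)) := (EuclideanSpace.basisFun (Fin m) ℝ).toBasis
    with hb_def
  obtain ⟨T, hTdef⟩ : ∃ T : Set (EuclideanSpace ℝ (Fin m)), T = (extChartAt I x).target := ⟨_, rfl⟩
  have hT : IsOpen T := by rw [hTdef]; exact isOpen_extChartAt_target x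
  have hTm : MeasurableSet T := hT.measurableSet
  have hsrc : (chartAt H x).source = (extChartAt I x).source :=
    (extChartAt_source (I := I) (x := x)).symm
  have hψT' : tsupport ψ ⊆ T := hTdef ▸ hψT
  obtain ⟨Gh, hGh⟩ : ∃ Gh : EuclideanSpace ℝ (Fin m) → Fin m → Fin m → ℝ,
      Gh = fun y i j ↦ chartGramMatrix h x y i j := ⟨_, rfl⟩
  have hofG : ∀ y, Matrix.of (Gh y) = chartGramMatrix h x y := fun y ↦ by
    rw [hGh]; rfl
  -- the zero extension `ζ` of `ψ ∘ φ`
  obtain ⟨ζ, hζdef⟩ : ∃ ζ : N → ℝ, ζ = (chartAt H x).source.indicator (ψ ∘ extChartAt I x) :=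
    ⟨_, rfl⟩
  have hψ2 : ContDiff ℝ 2 ψ := by exact_mod_cast contDiff_infty.1 hψ 2
  have hζs' : CMDiff ∞ ζ := by
    rw [hζdef]
    exact contMDiff_indicator_comp_extChartAt x hψ hψc hψT
  have hζs : CMDiff 2 ζ := hζs'.of_le (WithTop.coe_le_coe.mpr le_top)
  have hζc : HasCompactSupport ζ := by
    rw [hζdef]; exact hasCompactSupport_indicator_comp_extChartAt x hψc hψT
  obtain ⟨hts, -, hKS⟩ := tsupport_indicator_comp_extChartAt_subset (I := I) x hψc hψT
  have hζsupp : tsupport ζ ⊆ (extChartAt I x).source := by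
    rw [hζdef, ← hsrc]; exact hts.trans hKS
  have hζT : ∀ y ∈ T, ζ ((extChartAt I x).symm y) = ψ y := fun y hy ↦ by
    rw [hζdef]; exact indicator_comp_extChartAt_symm_apply x ψ (hTdef ▸ hy)
  -- the weak identity for `ζ`
  have hW := hweak ζ hζs' hζc
  -- regularity of the metric data on `T`
  have hGT : ∀ y ∈ T, ∀ i j, Gh y i j = (ofRiemannian h).val ((extChartAt I x).symm y)
      ((trivializationAt (EuclideanSpace ℝ (Fin m)) (TangentSpace I) x).localFrame b i
        ((extChartAt I x).symm y))
      ((trivializationAt (EuclideanSpace ℝ (Fin m)) (TangentSpace I) x).localFrame b j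
        ((extChartAt I x).symm y)) := by
    intro y hy i j
    rw [hGh]
    exact chartGramMatrix_apply_eq_val_localFrame h x (hTdef ▸ hy) i j
  have hGsm : ∀ i j, ContDiffOn ℝ ∞ (fun y ↦ Gh y i j) T := fun i j ↦ by
    rw [hTdef]
    exact (contDiffOn_gram_comp_extChartAt_symm b (ofRiemannian h) i j).congr
      (fun y hy ↦ hGT y (hTdef ▸ hy) i j)
  have hGpi : ContDiffOn ℝ ∞ Gh T :=
    contDiffOn_pi.2 fun i ↦ contDiffOn_pi.2 fun j ↦ hGsm i j
  have hGsym : ∀ z i j, Gh z i j = Gh z j i := fun z i j ↦ by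
    rw [hGh]; exact chartGramMatrix_apply_comm h x z i j
  have hdetpos : ∀ y ∈ T, 0 < (Matrix.of (Gh y)).det := fun y hy ↦ by
    rw [hofG]
    exact Real.sqrt_pos.1 (sqrt_det_chartGramMatrix_pos h x (hTdef ▸ hy))
  have hGdet : ContDiffOn ℝ ∞ (fun y ↦ (Matrix.of (Gh y)).det) T := by
    intro y hy
    have h1 := contMDiffAt_matrix_det (I := 𝓘(ℝ, EuclideanSpace ℝ (Fin m))) (k := ∞)
      (A := fun y ↦ Matrix.of (Gh y)) (x₀ := y)
      (fun i j ↦ contMDiffAt_iff_contDiffAt.2 ((hGsm i j).contDiffAt (hT.mem_nhds hy)))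
    exact (contMDiffAt_iff_contDiffAt.1 h1).contDiffWithinAt
  have hρ : ContDiffOn ℝ ∞ (fun y ↦ Real.sqrt (Matrix.of (Gh y)).det) T :=
    hGdet.sqrt fun y hy ↦ (hdetpos y hy).ne'
  have hGinv : ∀ i l, ContDiffOn ℝ ∞ (fun y ↦ (Matrix.of (Gh y))⁻¹ i l) T := by
    intro i l y hy
    have h1 := contMDiffAt_matrix_inv (I := 𝓘(ℝ, EuclideanSpace ℝ (Fin m))) (k := ∞)
      (A := fun y ↦ Matrix.of (Gh y)) (x₀ := y)
      (fun i j ↦ contMDiffAt_iff_contDiffAt.2 ((hGsm i j).contDiffAt (hT.mem_nhds hy)))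
      (hdetpos y hy).ne' i l
    exact (contMDiffAt_iff_contDiffAt.1 h1).contDiffWithinAt
  -- the coefficients `a i j = √g G⁻¹ j i` and the fluxes `W j = ∑ᵢ a i j ∂ᵢψ`
  obtain ⟨a, ha⟩ : ∃ a : Fin m → Fin m → EuclideanSpace ℝ (Fin m) → ℝ,
      a = fun i j z ↦ Real.sqrt (Matrix.of (Gh z)).det * (Matrix.of (Gh z))⁻¹ j i := ⟨_, rfl⟩
  have haT : ∀ i j, ContDiffOn ℝ ∞ (a i j) T := fun i j ↦ by
    rw [ha]; exact hρ.mul (hGinv j i)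
  obtain ⟨W, hWdef⟩ : ∃ W : Fin m → EuclideanSpace ℝ (Fin m) → ℝ, W = fun i y ↦
      Real.sqrt (Matrix.of (Gh y)).det * ∑ l, (Matrix.of (Gh y))⁻¹ i l * fderiv ℝ ψ y (b l) :=
    ⟨_, rfl⟩
  have hWa : ∀ j, W j = fun z ↦ ∑ i, a i j z * fderiv ℝ ψ z (b i) := by
    intro j
    rw [hWdef, ha]
    funext z
    dsimp only
    rw [Finset.mul_sum]
    refine Finset.sum_congr rfl fun i _ ↦ ?_
    ring
  have hdψ : ∀ l, ContDiff ℝ ∞ (fun y ↦ fderiv ℝ ψ y (b l)) := fun l ↦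
    (hψ.fderiv_right (m := ∞) (by exact_mod_cast le_top)).clm_apply contDiff_const
  have hmemS : ∀ y ∈ T, (extChartAt I x).symm y ∈ (chartAt H x).source := fun y hy ↦ by
    rw [hsrc]; exact (extChartAt I x).map_target (hTdef ▸ hy)
  have hright : ∀ y ∈ T, extChartAt I x ((extChartAt I x).symm y) = y := fun y hy ↦
    (extChartAt I x).right_inv (hTdef ▸ hy)
  have hTnhds : ∀ y ∈ T, T ∈ 𝓝 y := fun y hy ↦ hT.mem_nhds hy
  -- (1) the Laplacian of `ζ` in the chart, in divergence form: `√g Δζ ∘ φ⁻¹ = ∑ᵢ ∂ᵢ Wᵢ` on `T`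
  have hΔ : ∀ y ∈ T, Real.sqrt (Matrix.of (Gh y)).det *
      (ofRiemannian h).dalembertian ζ ((extChartAt I x).symm y) = ∑ i, fderiv ℝ (W i) y (b i) := by
    intro y hy
    have hGy : HasFDerivAt Gh (fderiv ℝ Gh y) y :=
      ((hGpi.contDiffAt (hTnhds y hy)).differentiableAt (by simp)).hasFDerivAt
    have hf2y : HasFDerivAt (fun z ↦ fderiv ℝ ψ z) (fderiv ℝ (fderiv ℝ ψ) y) y :=
      (((hψ2.fderiv_right (m := 1) (by norm_num)).contDiffAt).differentiableAt
        one_ne_zero).hasFDerivAt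
    have hL := dalembertian_eq_sum_localFrame (ofRiemannian h) b (hmemS y hy)
      (hζs ((extChartAt I x).symm y)) (Gh := Gh) (fh := ψ) (by
        rw [hright y hy]
        filter_upwards [hTnhds y hy] with z hz
        exact hGT z hz) (by
        rw [hright y hy]
        filter_upwards [hTnhds y hy] with z hz
        rw [Function.comp_apply, hζT z hz])
    rw [hright y hy] at hL
    have hC := Literature.Analysis.Calculus.coordLaplacian_mul_sqrt_det_eq_sum_fderiv b hGy hGsym
      (hdetpos y hy) hf2y
    rw [hL]
    simp only [Literature.Analysis.Calculus.fderiv_apply_apply_eq hGy] at hC ⊢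
    rw [hC, hWdef]
  -- (2) `∑ⱼ ∂ⱼ Wⱼ = ∑ᵢⱼ ∂ⱼ(a i j ∂ᵢψ)` on `T`
  have hdiv : ∀ y ∈ T, ∑ j, fderiv ℝ (W j) y (b j) =
      ∑ i, ∑ j, fderiv ℝ (fun z ↦ a i j z * fderiv ℝ ψ z (b i)) y (b j) := by
    intro y hy
    rw [Finset.sum_comm]
    refine Finset.sum_congr rfl fun j _ ↦ ?_
    rw [hWa j, fderiv_fun_sum fun i _ ↦ ?_]
    · simp only [FunLike.coe_sum, Finset.sum_apply]
    · exact (((haT i j).contDiffAt (hTnhds y hy)).differentiableAt (by simp)).mul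
        ((hdψ i).differentiable (by simp) y)
  -- (3) the left-hand side in the chart
  haveI : IsFiniteMeasureOnCompacts (riemannianMeasure h) :=
    ⟨fun K hK ↦ riemannianVolume_lt_top_of_isCompact_holds h le_rfl hK⟩
  have hΔc : Continuous ((ofRiemannian h).dalembertian ζ) := continuous_dalembertian _ hζs
  have hζcont : Continuous ζ := hζs.continuous
  have hsuppL : support (fun p ↦ u p * ((ofRiemannian h).dalembertian ζ p - f p * ζ p)) ⊆
      (extChartAt I x).source := by
    intro p hp
    rw [mem_support] at hp
    have hp' : (ofRiemannian h).dalembertian ζ p - f p * ζ p ≠ 0 := right_ne_zero_of_mul hp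
    refine hζsupp (by_contra fun hnot ↦ hp' ?_)
    rw [dalembertian_eq_zero_of_notMem_tsupport _ hnot, image_eq_zero_of_notMem_tsupport hnot,
      mul_zero, sub_zero]
  have hLHS : ∫ p, u p * ((ofRiemannian h).dalembertian ζ p - f p * ζ p) ∂riemannianMeasure h =
      ∫ y in T, u ((extChartAt I x).symm y) *
        ((∑ i, ∑ j, fderiv ℝ (fun z ↦ a i j z * fderiv ℝ ψ z (b i)) y (b j)) -
          (Real.sqrt (Matrix.of (Gh y)).det * f ((extChartAt I x).symm y)) * ψ y) := by
    have hmeas : Measurable (fun p ↦ u p * ((ofRiemannian h).dalembertian ζ p - f p * ζ p)) :=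
      hum.mul (hΔc.sub (hf.mul hζcont)).measurable
    rw [integral_eq_integral_chart h x hmeas hsuppL, ← hTdef]
    refine setIntegral_congr_fun hTm (fun y hy ↦ ?_)
    rw [smul_eq_mul, ← hofG, hζT y hy, ← hdiv y hy, ← hΔ y hy]
    ring
  -- (4) the right-hand side in the chart
  have hsuppR : support (fun p ↦ g p * ζ p) ⊆ (extChartAt I x).source := by
    intro p hp
    rw [mem_support] at hp
    exact hζsupp (subset_tsupport _ (right_ne_zero_of_mul hp))
  have hRHS : ∫ p, g p * ζ p ∂riemannianMeasure h =
      ∫ y in T, (Real.sqrt (Matrix.of (Gh y)).det * g ((extChartAt I x).symm y)) * ψ y := by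
    have hmR : Measurable (fun p ↦ g p * ζ p) := (hg.mul hζcont).measurable
    rw [integral_eq_integral_chart h x hmR hsuppR, ← hTdef]
    refine setIntegral_congr_fun hTm (fun y hy ↦ ?_)
    rw [smul_eq_mul, ← hofG, hζT y hy]
    ring
  -- (5) both target integrands vanish off `tsupport ψ ⊆ T`
  have hvan : ∀ y ∉ T, ∀ i j, fderiv ℝ (fun z ↦ a i j z * fderiv ℝ ψ z (b i)) y (b j) = 0 := by
    intro y hy i j
    have hy' : y ∉ tsupport ψ := fun h' ↦ hy (hψT' h')
    have hev : (fun z ↦ a i j z * fderiv ℝ ψ z (b i)) =ᶠ[𝓝 y] fun _ ↦ 0 := by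
      have h0 : ∀ᶠ z in 𝓝 y, z ∉ tsupport ψ :=
        (isClosed_tsupport ψ).isOpen_compl.mem_nhds hy'
      filter_upwards [h0] with z hz
      have : z ∉ tsupport (fderiv ℝ ψ) := fun h' ↦ hz (tsupport_fderiv_subset ℝ h')
      rw [image_eq_zero_of_notMem_tsupport this, zero_apply, mul_zero]
    rw [hev.fderiv_eq, fderiv_const_apply, zero_apply]
  have hψ0 : ∀ y ∉ T, ψ y = 0 := fun y hy ↦
    image_eq_zero_of_notMem_tsupport fun h' ↦ hy (hψT' h')
  rw [hLHS, hRHS] at hW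
  rw [setIntegral_eq_integral_of_forall_compl_eq_zero (s := T) (fun y hy ↦ by
      simp only [hvan y hy, Finset.sum_const_zero, hψ0 y hy, mul_zero, sub_zero]),
    setIntegral_eq_integral_of_forall_compl_eq_zero (s := T) (fun y hy ↦ by
      rw [hψ0 y hy, mul_zero])] at hW
  rw [ha] at hW
  simpa only [hofG] using hW

end ChartIdentity

/-! ### Interior regularity from the equation tested against smooth functions -/

section Assembly

variable {m : ℕ} {N : Type*} [TopologicalSpace N] [ChartedSpace (EuclideanSpace ℝ (Fin m)) N]
  [IsManifold (𝓡 m) ∞ N] [T2Space N] [LocallyCompactSpace N]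
  [MeasurableSpace N] [BorelSpace N]
  (h : ContMDiffRiemannianMetric (𝓡 m) ∞ (EuclideanSpace ℝ (Fin m)) (TangentSpace (𝓡 m) : N → Type _))
  [(ofRiemannian h).HasLeviCivita]

/-- **Interior regularity on the manifold, locally, from the equation tested against smooth
functions** (granted `Folland1995_cor634`): if `u` is measurable and locally integrable,
`f, g ∈ C^∞(N)`, and `∫ u (Δ_h ζ − f ζ) dμ_h = ∫ g ζ dμ_h` for all `ζ ∈ C^∞_c(N)` (the variant of
`exists_contMDiffOn_ae_eq_of_veryWeak`, whose proof only tests against such `ζ`), then every point has an open neighbourhood on which `u` agrees a.e. with a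
`C^∞` function (read the equation in a chart, `integral_comp_extChartAt_symm_divForm_of_veryWeak`,
apply `exists_contDiffOn_ae_eq_of_divForm_weak`, and pull the smooth representative back).
[cite: Folland2020, Cor. (6.34)] -/
theorem exists_contMDiffOn_ae_eq_of_veryWeak_smooth [Nontrivial (EuclideanSpace ℝ (Fin m))]
    (hF : Literature.Analysis.Distribution.Folland1995_cor634)
    {u : N → ℝ} (hum : Measurable u) (hu : LocallyIntegrable u (riemannianMeasure h))
    {f g : N → ℝ} (hf : ContMDiff (𝓡 m) 𝓘(ℝ, ℝ) ∞ f) (hg : ContMDiff (𝓡 m) 𝓘(ℝ, ℝ) ∞ g)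
    (hweak : ∀ ζ : N → ℝ, ContMDiff (𝓡 m) 𝓘(ℝ, ℝ) ∞ ζ → HasCompactSupport ζ →
      ∫ p, u p * ((ofRiemannian h).dalembertian ζ p - f p * ζ p) ∂riemannianMeasure h =
        ∫ p, g p * ζ p ∂riemannianMeasure h) (x : N) :
    ∃ V : Set N, IsOpen V ∧ x ∈ V ∧ ∃ w : N → ℝ, ContMDiffOn (𝓡 m) 𝓘(ℝ, ℝ) ∞ w V ∧
      ∀ᵐ p ∂riemannianMeasure h, p ∈ V → u p = w p := by
  classical
  set b : Module.Basis (Fin m) ℝ (EuclideanSpace ℝ (Fin m)) := (EuclideanSpace.basisFun (Fin m) ℝ).toBasis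
    with hb_def
  have hT : IsOpen (extChartAt (𝓡 m) x).target := isOpen_extChartAt_target x
  have hρ := contDiffOn_sqrt_det_chartGramMatrix h x
  -- the Euclidean regularity theorem in the chart at `x`
  obtain ⟨U, hUo, hxU, hUT, w, hw, hae⟩ :=
    Literature.Analysis.Distribution.exists_contDiffOn_ae_eq_of_divForm_weak
      (volume : Measure (EuclideanSpace ℝ (Fin m))) b hF hT
      (a := fun i j z ↦ Real.sqrt (chartGramMatrix h x z).det * (chartGramMatrix h x z)⁻¹ j i)
      (fun i j ↦ hρ.mul (contDiffOn_inv_chartGramMatrix_apply h x j i))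
      (fun y hy v hv ↦ divFormCoeff_chart_pos h x hy v hv)
      (c := fun y ↦ Real.sqrt (chartGramMatrix h x y).det * f ((extChartAt (𝓡 m) x).symm y))
      (hρ.mul (contDiffOn_comp_extChartAt_symm hf))
      (G := fun y ↦ Real.sqrt (chartGramMatrix h x y).det * g ((extChartAt (𝓡 m) x).symm y))
      (hρ.mul (contDiffOn_comp_extChartAt_symm hg))
      (locallyIntegrableOn_comp_extChartAt_symm h x hum hu)
      (fun ψ hψ hψc hψT ↦ integral_comp_extChartAt_symm_divForm_of_veryWeak_smooth h x hum hf.continuous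
        hg.continuous hweak hψ hψc hψT)
      ((extChartAt (𝓡 m) x).map_source (mem_extChartAt_source x))
  -- pull back
  obtain ⟨V, hV⟩ : ∃ V : Set N, V = (extChartAt (𝓡 m) x).source ∩ extChartAt (𝓡 m) x ⁻¹' U :=
    ⟨_, rfl⟩
  have hVo : IsOpen V := by
    rw [hV]; exact (continuousOn_extChartAt x).isOpen_inter_preimage (isOpen_extChartAt_source x) hUo
  have hxV : x ∈ V := by rw [hV]; exact ⟨mem_extChartAt_source x, hxU⟩
  refine ⟨V, hVo, hxV, w ∘ extChartAt (𝓡 m) x, ?_, ?_⟩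
  · have hwU : ContMDiffOn 𝓘(ℝ, EuclideanSpace ℝ (Fin m)) 𝓘(ℝ, ℝ) ∞ w U :=
      contMDiffOn_iff_contDiffOn.2 hw
    have hφ0 : ContMDiffOn (𝓡 m) 𝓘(ℝ, EuclideanSpace ℝ (Fin m)) ∞ (extChartAt (𝓡 m) x)
        (extChartAt (𝓡 m) x).source := by
      rw [extChartAt_source]
      exact contMDiffOn_extChartAt
    have hφ : ContMDiffOn (𝓡 m) 𝓘(ℝ, EuclideanSpace ℝ (Fin m)) ∞ (extChartAt (𝓡 m) x) V := by
      rw [hV]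
      exact hφ0.mono inter_subset_left
    exact hwU.comp hφ (fun p hp ↦ by rw [hV] at hp; exact hp.2)
  · have := ae_comp_extChartAt_of_ae_target h x (P := fun y ↦ u ((extChartAt (𝓡 m) x).symm y) = w y)
      hae
    filter_upwards [this] with p hp hpV
    rw [hV] at hpV
    have h1 := hp hpV.1 hpV.2
    rw [(extChartAt (𝓡 m) x).left_inv hpV.1] at h1
    exact h1


/-- **Smooth classical solutions from the equation tested against smooth functions, on a closed
manifold.** If `u ∈ L¹(N, μ_h)` on a closed Riemannian manifold satisfies
`∫ u (Δ_h ζ − f ζ) dμ_h = ∫ g ζ dμ_h` for all smooth `ζ`, with `f, g` smooth, then `u` agrees a.e.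
with a smooth `v` solving `Δ_h v − f v = g` classically (interior regularity
`exists_contMDiffOn_ae_eq_of_veryWeak_smooth` with Folland's Cor. (6.34),
`Folland1995_cor634_holds`; patching `exists_contMDiff_ae_eq_of_forall_exists_nhds`; and
`dalembertian_sub_mul_eq_of_veryWeak`). [cite: Folland2020, Cor. (6.34)]
[cite: SchoenYauPMT1979, proof of Lemma 3.2 (p. 65)] -/
theorem exists_contMDiff_ae_eq_dalembertian_sub_mul_eq [CompactSpace N]
    [Nontrivial (EuclideanSpace ℝ (Fin m))] {u : N → ℝ}
    (hu : Integrable u (riemannianMeasure h)) {f g : N → ℝ} (hf : ContMDiff (𝓡 m) 𝓘(ℝ, ℝ) ∞ f)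
    (hg : ContMDiff (𝓡 m) 𝓘(ℝ, ℝ) ∞ g)
    (hweak : ∀ ζ : N → ℝ, ContMDiff (𝓡 m) 𝓘(ℝ, ℝ) ∞ ζ →
      ∫ p, u p * ((ofRiemannian h).dalembertian ζ p - f p * ζ p) ∂riemannianMeasure h =
        ∫ p, g p * ζ p ∂riemannianMeasure h) :
    ∃ v : N → ℝ, ContMDiff (𝓡 m) 𝓘(ℝ, ℝ) ∞ v ∧ (∀ᵐ p ∂riemannianMeasure h, u p = v p) ∧
      ∀ x, (ofRiemannian h).dalembertian v x - f x * v x = g x := by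
  classical
  set μ : Measure N := riemannianMeasure h with hμ
  haveI : IsFiniteMeasureOnCompacts μ :=
    ⟨fun K hK ↦ riemannianVolume_lt_top_of_isCompact_holds h le_rfl hK⟩
  haveI : μ.IsOpenPosMeasure := isOpenPosMeasure_riemannianMeasure h
  -- a measurable representative
  set u' : N → ℝ := hu.1.mk u with hu'
  have huu' : u =ᵐ[μ] u' := hu.1.ae_eq_mk
  have hu'm : Measurable u' := hu.1.stronglyMeasurable_mk.measurable
  have hu'i : Integrable u' μ := hu.congr huu'
  have hu'li : LocallyIntegrable u' μ := hu'i.locallyIntegrable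
  have hweak' : ∀ ζ : N → ℝ, ContMDiff (𝓡 m) 𝓘(ℝ, ℝ) ∞ ζ → HasCompactSupport ζ →
      ∫ p, u' p * ((ofRiemannian h).dalembertian ζ p - f p * ζ p) ∂μ = ∫ p, g p * ζ p ∂μ := by
    intro ζ hζ _
    rw [← hweak ζ hζ]
    refine integral_congr_ae ?_
    filter_upwards [huu'] with p hp
    rw [hp]
  have hloc := exists_contMDiffOn_ae_eq_of_veryWeak_smooth h
    Literature.Analysis.Distribution.Folland1995_cor634_holds hu'm hu'li hf hg hweak'
  obtain ⟨v, hv, hu'v⟩ := exists_contMDiff_ae_eq_of_forall_exists_nhds (m := m) (μ := μ) hloc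
  have huv : u =ᵐ[μ] v := huu'.trans hu'v
  refine ⟨v, hv, huv, fun x ↦ ?_⟩
  refine dalembertian_sub_mul_eq_of_veryWeak h hv hf.continuous hg.continuous (fun ζ hζ hζc ↦ ?_) x
  rw [← hweak' ζ hζ hζc]
  refine integral_congr_ae ?_
  filter_upwards [hu'v] with p hp
  rw [hp]

end Assembly


end Regularity

section Positivity

open scoped ENNReal


section PDE

variable {m : ℕ} {M : Type*} [TopologicalSpace M] [T2Space M]
  [ChartedSpace (EuclideanSpace ℝ (Fin m)) M] [IsManifold (𝓡 m) ∞ M] [CompactSpace M]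
  [MeasurableSpace M] [BorelSpace M]
  (G : PseudoRiemannianMetric (𝓡 m) ∞ (EuclideanSpace ℝ (Fin m)) (TangentSpace (𝓡 m) : M → Type _))
  [G.HasLeviCivita]

/-! #### Smooth approximation from below of a continuous function -/

omit [CompactSpace M] [MeasurableSpace M] [BorelSpace M] in
/-- **A continuous function has smooth approximations from below**: for `σ` continuous on a
σ-compact Hausdorff manifold and `ε > 0` there is a smooth `σ̃` with `σ − ε < σ̃ < σ` pointwise
(smooth partitions of unity: the constraint sets are convex and locally a constant works;
Mathlib's `exists_contMDiffMap_forall_mem_convex_of_local_const`). [folklore] -/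
theorem exists_contMDiff_sub_lt_lt [SigmaCompactSpace M] {σ : M → ℝ} (hσ : Continuous σ) {ε : ℝ}
    (hε : 0 < ε) :
    ∃ σ' : M → ℝ, ContMDiff (𝓡 m) 𝓘(ℝ, ℝ) ∞ σ' ∧ ∀ x, σ x - ε < σ' x ∧ σ' x < σ x := by
  obtain ⟨s, hs⟩ := exists_contMDiffMap_forall_mem_convex_of_local_const (I := 𝓡 m) (n := ⊤)
    (F := ℝ) (t := fun x ↦ Set.Ioo (σ x - ε) (σ x)) (fun x ↦ convex_Ioo _ _) (fun x ↦ by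
      refine ⟨σ x - ε / 2, ?_⟩
      have h1 : ∀ᶠ y in 𝓝 x, σ y ∈ Set.Ioo (σ x - ε / 2) (σ x + ε / 2) :=
        hσ.continuousAt.eventually_mem (Ioo_mem_nhds (by linarith) (by linarith))
      filter_upwards [h1] with y hy
      exact ⟨by linarith [hy.2], by linarith [hy.1]⟩)
  exact ⟨s, s.contMDiff, fun x ↦ hs x⟩

/-! #### Coercivity on all smooth functions from coercivity on positive ones -/

omit [T2Space M] [CompactSpace M] [MeasurableSpace M] [BorelSpace M] [G.HasLeviCivita] in
/-- **Gradient of a composite with a real function**: `|∇(η ∘ u)|²_G = η'(u)² |∇u|²_G`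
(`d(η ∘ u) = η'(u) du`; the lemma `gradSq_real_comp_eq_deriv_sq_mul` of
`SchoenYauStableSurface.lean`, restated to keep the import closure small). [folklore] -/
theorem gradSq_real_comp_eq {u : M → ℝ} {η : ℝ → ℝ} {x : M}
    (hη : DifferentiableAt ℝ η (u x)) (hu : MDifferentiableAt (𝓡 m) 𝓘(ℝ, ℝ) u x) :
    G.gradSq (η ∘ u) x = deriv η (u x) ^ 2 * G.gradSq u x := by
  have hd : mvfderiv (𝓡 m) (η ∘ u) x = deriv η (u x) • mvfderiv (𝓡 m) u x := by
    ext v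
    rw [mvfderiv_real_comp hη hu v, _root_.smul_apply, smul_eq_mul]
  simp only [gradSq_eq, hd, ContinuousLinearMap.toLinearMap_smul, map_smul, _root_.smul_apply,
    smul_eq_mul]
  ring

omit [G.HasLeviCivita] in
/-- **The coercivity estimate passes from positive to arbitrary smooth functions.** If
`c (∫ u⁴)^{1/2} ≤ ∫ (6 |∇u|²_G + V u²) dV_G` for all smooth *positive* `u`, then the same holds for
every smooth `φ`: apply the hypothesis to `u_δ = (φ² + δ²)^{1/2}`, which is smooth and positive
with `|∇u_δ|² = (φ²/(φ² + δ²)) |∇φ|² ≤ |∇φ|²`, `u_δ² = φ² + δ²`, `u_δ⁴ ≥ φ⁴`, and let `δ → 0`.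
[folklore] -/
theorem coercive_of_coercive_pos (hG : G.IsRiemannian) {V : M → ℝ} (hV : Continuous V) {c : ℝ}
    (hc : 0 ≤ c)
    (hY : ∀ u : M → ℝ, ContMDiff (𝓡 m) 𝓘(ℝ, ℝ) ∞ u → (∀ x, 0 < u x) →
      c * Real.sqrt (∫ x, u x ^ 4 ∂(riemannianMeasure (G.toContMDiffRiemannianMetric hG))) ≤
        ∫ x, (6 * G.gradSq u x + V x * u x ^ 2)
          ∂(riemannianMeasure (G.toContMDiffRiemannianMetric hG)))
    {φ : M → ℝ} (hφ : ContMDiff (𝓡 m) 𝓘(ℝ, ℝ) ∞ φ) :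
    c * Real.sqrt (∫ x, φ x ^ 4 ∂(riemannianMeasure (G.toContMDiffRiemannianMetric hG))) ≤
      ∫ x, (6 * G.gradSq φ x + V x * φ x ^ 2)
        ∂(riemannianMeasure (G.toContMDiffRiemannianMetric hG)) := by
  set h := G.toContMDiffRiemannianMetric hG with hh
  set μ : Measure M := riemannianMeasure h with hμ
  haveI : IsFiniteMeasure μ := isFiniteMeasure_riemannianMeasure h
  have hφc : Continuous φ := hφ.continuous
  have hφ1 : ContMDiff (𝓡 m) 𝓘(ℝ, ℝ) 1 φ := hφ.of_le (by exact_mod_cast le_top)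
  have hgradc : Continuous (G.gradSq φ) := continuous_innerDual_mvfderiv G hφ1 hφ1
  have hgrad0 : ∀ x, 0 ≤ G.gradSq φ x := fun x ↦ innerDual_self_nonneg h x _
  -- the right-hand side for `φ` and the constant `K₀ = ∫ |V|`
  set R : ℝ := ∫ x, (6 * G.gradSq φ x + V x * φ x ^ 2) ∂μ with hR
  set K₀ : ℝ := ∫ x, |V x| ∂μ with hK₀
  have hK₀0 : 0 ≤ K₀ := integral_nonneg fun x ↦ abs_nonneg _
  -- for every `δ > 0`: `c √(∫ φ⁴) ≤ R + δ² K₀`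
  have key : ∀ δ : ℝ, 0 < δ → c * Real.sqrt (∫ x, φ x ^ 4 ∂μ) ≤ R + δ ^ 2 * K₀ := by
    intro δ hδ
    set η : ℝ → ℝ := fun t ↦ Real.sqrt (t ^ 2 + δ ^ 2) with hη
    have hpos_in : ∀ t : ℝ, 0 < t ^ 2 + δ ^ 2 := fun t ↦ by positivity
    have hηd : ∀ t, HasDerivAt η (2 * t / (2 * Real.sqrt (t ^ 2 + δ ^ 2))) t := fun t ↦ by
      have h1 : HasDerivAt (fun t : ℝ ↦ t ^ 2 + δ ^ 2) (2 * t) t := by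
        simpa using (hasDerivAt_pow 2 t).add_const (δ ^ 2)
      exact h1.sqrt (hpos_in t).ne'
    have hηderiv : ∀ t, deriv η t = t / Real.sqrt (t ^ 2 + δ ^ 2) := fun t ↦ by
      rw [(hηd t).deriv]
      have hs : 0 < Real.sqrt (t ^ 2 + δ ^ 2) := Real.sqrt_pos.2 (hpos_in t)
      field_simp
    have hηsq : ∀ t, deriv η t ^ 2 ≤ 1 := fun t ↦ by
      rw [hηderiv, div_pow, Real.sq_sqrt (hpos_in t).le, div_le_one (hpos_in t)]
      nlinarith
    have hηC : ContDiff ℝ ∞ η := by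
      rw [hη]
      exact (contDiff_id.pow 2 |>.add contDiff_const).sqrt fun t ↦ (hpos_in t).ne'
    set u : M → ℝ := η ∘ φ with hu
    have hus : ContMDiff (𝓡 m) 𝓘(ℝ, ℝ) ∞ u := hηC.comp_contMDiff hφ
    have hupos : ∀ x, 0 < u x := fun x ↦ Real.sqrt_pos.2 (hpos_in (φ x))
    have husq : ∀ x, u x ^ 2 = φ x ^ 2 + δ ^ 2 := fun x ↦ Real.sq_sqrt (hpos_in (φ x)).le
    have hu4 : ∀ x, φ x ^ 4 ≤ u x ^ 4 := fun x ↦ by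
      rw [show u x ^ 4 = (u x ^ 2) ^ 2 by ring, husq]
      nlinarith [sq_nonneg (φ x), sq_nonneg δ]
    have hgrad : ∀ x, G.gradSq u x ≤ G.gradSq φ x := fun x ↦ by
      rw [hu, gradSq_real_comp_eq G (hηC.contDiffAt.differentiableAt (by simp))
        ((hφ x).mdifferentiableAt (by simp))]
      calc deriv η (φ x) ^ 2 * G.gradSq φ x ≤ 1 * G.gradSq φ x :=
            mul_le_mul_of_nonneg_right (hηsq (φ x)) (hgrad0 x)
        _ = G.gradSq φ x := one_mul _
    have huc : Continuous u := hus.continuous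
    have hu1 : ContMDiff (𝓡 m) 𝓘(ℝ, ℝ) 1 u := hus.of_le (by exact_mod_cast le_top)
    have hgraduc : Continuous (G.gradSq u) := continuous_innerDual_mvfderiv G hu1 hu1
    -- the hypothesis at `u`
    have hYu := hY u hus hupos
    -- compare the two sides
    have hL : c * Real.sqrt (∫ x, φ x ^ 4 ∂μ) ≤ c * Real.sqrt (∫ x, u x ^ 4 ∂μ) := by
      refine mul_le_mul_of_nonneg_left (Real.sqrt_le_sqrt ?_) hc
      exact integral_mono (integrable_of_continuous h (hφc.pow 4))
        (integrable_of_continuous h (huc.pow 4)) hu4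
    have hRu : ∫ x, (6 * G.gradSq u x + V x * u x ^ 2) ∂μ ≤ R + δ ^ 2 * K₀ := by
      have hpt : ∀ x, 6 * G.gradSq u x + V x * u x ^ 2 ≤
          (6 * G.gradSq φ x + V x * φ x ^ 2) + δ ^ 2 * |V x| := fun x ↦ by
        rw [husq]
        nlinarith [hgrad x, le_abs_self (V x), sq_nonneg δ]
      have hiu : Integrable (fun x ↦ 6 * G.gradSq u x + V x * u x ^ 2) μ :=
        integrable_of_continuous h ((continuous_const.mul hgraduc).add (hV.mul (huc.pow 2)))
      have hiφ : Integrable (fun x ↦ 6 * G.gradSq φ x + V x * φ x ^ 2) μ :=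
        integrable_of_continuous h ((continuous_const.mul hgradc).add (hV.mul (hφc.pow 2)))
      have hiV : Integrable (fun x ↦ δ ^ 2 * |V x|) μ :=
        integrable_of_continuous h (continuous_const.mul hV.abs)
      have hisum : Integrable (fun x ↦ (6 * G.gradSq φ x + V x * φ x ^ 2) + δ ^ 2 * |V x|) μ :=
        integrable_of_continuous h (((continuous_const.mul hgradc).add (hV.mul (hφc.pow 2))).add
          (continuous_const.mul hV.abs))
      calc ∫ x, (6 * G.gradSq u x + V x * u x ^ 2) ∂μ
          ≤ ∫ x, ((6 * G.gradSq φ x + V x * φ x ^ 2) + δ ^ 2 * |V x|) ∂μ :=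
            integral_mono hiu hisum hpt
        _ = R + δ ^ 2 * K₀ := by
            rw [integral_add hiφ hiV, integral_const_mul]
    exact hL.trans (hYu.trans hRu)
  -- let `δ → 0`
  refine le_of_forall_pos_lt_add fun ε' hε' ↦ ?_
  have hδ : 0 < Real.sqrt (ε' / (K₀ + 1)) := Real.sqrt_pos.2 (div_pos hε' (by linarith))
  have h1 := key _ hδ
  rw [Real.sq_sqrt (div_pos hε' (by linarith)).le] at h1
  have h2 : ε' / (K₀ + 1) * K₀ < ε' := by
    rw [div_mul_eq_mul_div, div_lt_iff₀ (by linarith)]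
    nlinarith
  linarith

/-! #### `∫ φ² ≤ √Vol · (∫ φ⁴)^{1/2}` -/

/-- Cauchy–Schwarz on a finite measure space: `∫ φ² dμ ≤ √(μ M) √(∫ φ⁴ dμ)` for continuous `φ`
on a compact space. [folklore] -/
theorem integral_sq_le_sqrt_measure_mul_sqrt {X : Type*} [MeasurableSpace X] [TopologicalSpace X]
    [OpensMeasurableSpace X] [CompactSpace X] {μ : Measure X} [IsFiniteMeasure μ] {φ : X → ℝ}
    (hφ : Continuous φ) :
    ∫ x, φ x ^ 2 ∂μ ≤ Real.sqrt (μ univ).toReal * Real.sqrt (∫ x, φ x ^ 4 ∂μ) := by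
  have hpq : (2 : ℝ).HolderConjugate 2 := Real.holderConjugate_iff.2 ⟨by norm_num, by norm_num⟩
  have hf : MemLp (fun x ↦ φ x ^ 2) (ENNReal.ofReal 2) μ :=
    ⟨(hφ.pow 2).aestronglyMeasurable, eLpNorm_lt_top_of_continuous (hφ.pow 2) _⟩
  have hg : MemLp (fun _ : X ↦ (1 : ℝ)) (ENNReal.ofReal 2) μ := memLp_const 1
  have h := integral_mul_le_Lp_mul_Lq_of_nonneg hpq (Eventually.of_forall fun x ↦ sq_nonneg (φ x))
    (Eventually.of_forall fun _ ↦ zero_le_one) hf hg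
  have h4 : ∀ x, (φ x ^ 2) ^ (2 : ℝ) = φ x ^ 4 := fun x ↦ by
    rw [show (2 : ℝ) = ((2 : ℕ) : ℝ) by norm_num, Real.rpow_natCast]; ring
  have hl : ∫ x, φ x ^ 2 * 1 ∂μ = ∫ x, φ x ^ 2 ∂μ :=
    integral_congr_ae (Eventually.of_forall fun x ↦ mul_one _)
  have hr1 : ∫ x, (φ x ^ 2) ^ (2 : ℝ) ∂μ = ∫ x, φ x ^ 4 ∂μ :=
    integral_congr_ae (Eventually.of_forall h4)
  have hr2 : ∫ x, (1 : ℝ) ^ (2 : ℝ) ∂μ = (μ univ).toReal := by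
    simp only [Real.one_rpow, integral_const, smul_eq_mul, mul_one]
    rfl
  rw [hl, hr1, hr2] at h
  calc ∫ x, φ x ^ 2 ∂μ ≤ (∫ x, φ x ^ 4 ∂μ) ^ (1 / 2 : ℝ) * ((μ univ).toReal) ^ (1 / 2 : ℝ) := h
    _ = Real.sqrt (μ univ).toReal * Real.sqrt (∫ x, φ x ^ 4 ∂μ) := by
        rw [← Real.sqrt_eq_rpow, ← Real.sqrt_eq_rpow, mul_comm]

/-! #### Positivity of the solution of the coercive equation -/

/-- **Solutions of `−6Δ_G v + σ v = 1` are positive when the form `∫(6|∇w|² + σw²)` is coercive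
on smooth functions.** Let `G` be a smooth Riemannian metric on a closed manifold, `σ` continuous,
`v` smooth with `Δ_G v = (σ v − 1)/6`, and suppose `c (∫ w⁴)^{1/2} ≤ ∫ (6|∇w|²_G + σ w²) dV_G` for
all smooth `w` with `c > 0`. Then `v > 0` everywhere.

*Proof.* (i) `v ≥ 0`: for `δ > 0` the smooth function `w = (v − (v² + δ²)^{1/2})/2 ≤ −v⁻ ≤ 0` has
`dw = ψ dv` with `0 ≤ ψ = (1 − v(v² + δ²)^{-1/2})/2 ≤ 1` and `w(w − v) = δ²/4` identically, so
Green's identity (`∫ 6 G⁻¹(dv, dw) + σ v w = ∫ w`, from the equation) gives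
`∫(6|∇w|² + σw²) ≤ ∫(6ψ|∇v|² + σ v w) + ∫σ(w² − vw) = ∫ w + (δ²/4)∫σ ≤ (δ²/4)∫|σ|`, whence
`c (∫ (v⁻)⁴)^{1/2} ≤ c (∫ w⁴)^{1/2} ≤ (δ²/4)∫|σ|` for every `δ > 0` and `v⁻ = 0`. (ii) `v > 0`: at a
zero `x₀` of `v ≥ 0`, E. Hopf's minimum principle for `Δ_G v ≤ (σ⁺/6) v`
(`dalembertian_supersolution_eventually_eq`) makes `v ≡ 0` near `x₀`, so `Δ_G v(x₀) = 0`,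
contradicting `Δ_G v(x₀) = −1/6`. [cite: LopezGomez2012, Thm. 1.2]
[cite: GurskyLebrun1999, Prop. 3 (positivity of the ground state of the modified conformal Laplacian)] -/
theorem pos_of_dalembertian_eq_of_coercive (hG : G.IsRiemannian) {σ : M → ℝ} (hσ : Continuous σ)
    {v : M → ℝ} (hv : ContMDiff (𝓡 m) 𝓘(ℝ, ℝ) ∞ v)
    (heq : ∀ x, G.dalembertian v x = (σ x * v x - 1) / 6) {c : ℝ} (hc : 0 < c)
    (hcoer : ∀ w : M → ℝ, ContMDiff (𝓡 m) 𝓘(ℝ, ℝ) ∞ w →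
      c * Real.sqrt (∫ x, w x ^ 4 ∂(riemannianMeasure (G.toContMDiffRiemannianMetric hG))) ≤
        ∫ x, (6 * G.gradSq w x + σ x * w x ^ 2)
          ∂(riemannianMeasure (G.toContMDiffRiemannianMetric hG))) :
    ∀ x, 0 < v x := by
  set h := G.toContMDiffRiemannianMetric hG with hh
  haveI hLC : (ofRiemannian h).HasLeviCivita := ‹G.HasLeviCivita›
  set μ : Measure M := riemannianMeasure h with hμ
  haveI : IsFiniteMeasure μ := isFiniteMeasure_riemannianMeasure h
  haveI : μ.IsOpenPosMeasure := isOpenPosMeasure_riemannianMeasure h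
  have hvc : Continuous v := hv.continuous
  have hv1 : ContMDiff (𝓡 m) 𝓘(ℝ, ℝ) 1 v := hv.of_le (by exact_mod_cast le_top)
  have hv2 : ContMDiff (𝓡 m) 𝓘(ℝ, ℝ) 2 v := hv.of_le (WithTop.coe_le_coe.mpr le_top)
  have hgrad0 : ∀ x, 0 ≤ G.gradSq v x := fun x ↦ innerDual_self_nonneg h x _
  have hgradvc : Continuous (G.gradSq v) := continuous_innerDual_mvfderiv G hv1 hv1
  set K₀ : ℝ := ∫ x, |σ x| ∂μ with hK₀
  have hK₀0 : 0 ≤ K₀ := integral_nonneg fun x ↦ abs_nonneg _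
  /- (i) `v ≥ 0` -/
  have hnonneg : ∀ x, 0 ≤ v x := by
    -- the negative part `v⁻` and the bound `c √(∫ (v⁻)⁴) ≤ (δ²/4) K₀`
    set vm : M → ℝ := fun x ↦ max (-v x) 0 with hvm
    have hvmc : Continuous vm := hvc.neg.max continuous_const
    have key : ∀ δ : ℝ, 0 < δ → c * Real.sqrt (∫ x, vm x ^ 4 ∂μ) ≤ δ ^ 2 / 4 * K₀ := by
      intro δ hδ
      set η : ℝ → ℝ := fun t ↦ (t - Real.sqrt (t ^ 2 + δ ^ 2)) / 2 with hη
      have hpos_in : ∀ t : ℝ, 0 < t ^ 2 + δ ^ 2 := fun t ↦ by positivity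
      have hs_pos : ∀ t, 0 < Real.sqrt (t ^ 2 + δ ^ 2) := fun t ↦ Real.sqrt_pos.2 (hpos_in t)
      have hs_ge : ∀ t, |t| ≤ Real.sqrt (t ^ 2 + δ ^ 2) := fun t ↦ by
        rw [← Real.sqrt_sq_eq_abs]
        exact Real.sqrt_le_sqrt (by nlinarith)
      have hηd : ∀ t, HasDerivAt η ((1 - 2 * t / (2 * Real.sqrt (t ^ 2 + δ ^ 2))) / 2) t := by
        intro t
        have h1 : HasDerivAt (fun t : ℝ ↦ t ^ 2 + δ ^ 2) (2 * t) t := by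
          simpa using (hasDerivAt_pow 2 t).add_const (δ ^ 2)
        exact ((hasDerivAt_id t).sub (h1.sqrt (hpos_in t).ne')).div_const 2
      have hηderiv : ∀ t, deriv η t = (1 - t / Real.sqrt (t ^ 2 + δ ^ 2)) / 2 := fun t ↦ by
        rw [(hηd t).deriv]
        have hs := hs_pos t
        field_simp
      have hψ01 : ∀ t, 0 ≤ deriv η t ∧ deriv η t ≤ 1 := fun t ↦ by
        rw [hηderiv]
        have hs := hs_pos t
        have hq : -1 ≤ t / Real.sqrt (t ^ 2 + δ ^ 2) ∧ t / Real.sqrt (t ^ 2 + δ ^ 2) ≤ 1 := by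
          rw [← abs_le, abs_div, abs_of_pos hs, div_le_one hs]
          exact hs_ge t
        constructor <;> nlinarith [hq.1, hq.2]
      have hηC : ContDiff ℝ ∞ η := by
        rw [hη]
        exact (contDiff_id.sub ((contDiff_id.pow 2 |>.add contDiff_const).sqrt
          fun t ↦ (hpos_in t).ne')).div_const 2
      -- the test function `w = η ∘ v`
      set w : M → ℝ := η ∘ v with hw
      have hws : ContMDiff (𝓡 m) 𝓘(ℝ, ℝ) ∞ w := hηC.comp_contMDiff hv
      have hwc : Continuous w := hws.continuous
      have hw1 : ContMDiff (𝓡 m) 𝓘(ℝ, ℝ) 1 w := hws.of_le (by exact_mod_cast le_top)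
      have hwle : ∀ x, w x ≤ 0 := fun x ↦ by
        show (v x - Real.sqrt (v x ^ 2 + δ ^ 2)) / 2 ≤ 0
        linarith [hs_ge (v x), le_abs_self (v x)]
      have hwvm : ∀ x, vm x ≤ -w x := fun x ↦ by
        show max (-v x) 0 ≤ -((v x - Real.sqrt (v x ^ 2 + δ ^ 2)) / 2)
        refine max_le ?_ ?_ <;> linarith [hs_ge (v x), le_abs_self (v x), neg_abs_le (v x)]
      have hwid : ∀ x, w x * (w x - v x) = δ ^ 2 / 4 := fun x ↦ by
        show (v x - Real.sqrt (v x ^ 2 + δ ^ 2)) / 2 *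
          ((v x - Real.sqrt (v x ^ 2 + δ ^ 2)) / 2 - v x) = δ ^ 2 / 4
        have hsq : Real.sqrt (v x ^ 2 + δ ^ 2) ^ 2 = v x ^ 2 + δ ^ 2 := Real.sq_sqrt (hpos_in _).le
        nlinarith [hsq]
      -- derivatives of `w`
      have hdw : ∀ x, mvfderiv (𝓡 m) w x = deriv η (v x) • mvfderiv (𝓡 m) v x := fun x ↦ by
        ext u
        rw [hw, mvfderiv_real_comp (hηC.contDiffAt.differentiableAt (by simp))
          ((hv x).mdifferentiableAt (by simp)) u, _root_.smul_apply, smul_eq_mul]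
      have hgradw : ∀ x, G.gradSq w x = deriv η (v x) ^ 2 * G.gradSq v x := fun x ↦ by
        rw [hw, gradSq_real_comp_eq G (hηC.contDiffAt.differentiableAt (by simp))
          ((hv x).mdifferentiableAt (by simp))]
      have hcross : ∀ x, G.innerDual x (mvfderiv (𝓡 m) v x).toLinearMap
          (mvfderiv (𝓡 m) w x).toLinearMap = deriv η (v x) * G.gradSq v x := fun x ↦ by
        rw [hdw x, ContinuousLinearMap.toLinearMap_smul]
        simp only [PseudoRiemannianMetric.innerDual, map_smul, smul_eq_mul, gradSq_eq]
        rfl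
      -- Green: `∫ 6 G⁻¹(dv, dw) + σ v w = ∫ w`
      have hGreen := integral_mul_dalembertian_eq_neg_integral_innerDual h (u := w) (f := v) hw1 hv2
      have hGreen' : ∫ x, w x * G.dalembertian v x ∂μ =
          -∫ x, G.innerDual x (mvfderiv (𝓡 m) w x).toLinearMap (mvfderiv (𝓡 m) v x).toLinearMap ∂μ :=
        hGreen
      have hsymm : ∀ x, G.innerDual x (mvfderiv (𝓡 m) w x).toLinearMap
          (mvfderiv (𝓡 m) v x).toLinearMap = deriv η (v x) * G.gradSq v x := fun x ↦ by
        rw [G.innerDual_comm x, hcross x]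
      have hident : ∫ x, (6 * (deriv η (v x) * G.gradSq v x) + σ x * v x * w x) ∂μ =
          ∫ x, w x ∂μ := by
        have hi1 : Integrable (fun x ↦ deriv η (v x) * G.gradSq v x) μ := by
          have : Continuous fun x ↦ deriv η (v x) * G.gradSq v x :=
            ((hηC.continuous_deriv (by simp)).comp hvc).mul hgradvc
          exact integrable_of_continuous h this
        have hi2 : Integrable (fun x ↦ σ x * v x * w x) μ :=
          integrable_of_continuous h ((hσ.mul hvc).mul hwc)
        have hΔ : ∫ x, w x * G.dalembertian v x ∂μ = -∫ x, deriv η (v x) * G.gradSq v x ∂μ := by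
          rw [hGreen']
          congr 1
          exact integral_congr_ae (Eventually.of_forall hsymm)
        have hΔ' : ∫ x, w x * G.dalembertian v x ∂μ = ∫ x, (σ x * v x * w x - w x) / 6 ∂μ :=
          integral_congr_ae (Eventually.of_forall fun x ↦ by
            show w x * G.dalembertian v x = (σ x * v x * w x - w x) / 6
            rw [heq x]; ring)
        have hi3 : Integrable (fun x ↦ (σ x * v x * w x - w x) / 6) μ :=
          integrable_of_continuous h ((((hσ.mul hvc).mul hwc).sub hwc).div_const 6)
        have hwi : Integrable w μ := integrable_of_continuous h hwc
        have e1 : ∫ x, (σ x * v x * w x - w x) / 6 ∂μ =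
            (∫ x, σ x * v x * w x ∂μ - ∫ x, w x ∂μ) / 6 := by
          rw [← integral_sub hi2 hwi, ← integral_div]
        rw [integral_add (hi1.const_mul 6) hi2, integral_const_mul]
        have := hΔ.symm.trans hΔ'
        rw [e1] at this
        linarith
      -- the chain of inequalities
      have hcoerw := hcoer w hws
      have hup : ∫ x, (6 * G.gradSq w x + σ x * w x ^ 2) ∂μ ≤ δ ^ 2 / 4 * K₀ := by
        have hpt : ∀ x, 6 * G.gradSq w x + σ x * w x ^ 2 ≤
            (6 * (deriv η (v x) * G.gradSq v x) + σ x * v x * w x) + δ ^ 2 / 4 * |σ x| := by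
          intro x
          rw [hgradw x]
          have hsq : σ x * w x ^ 2 = σ x * v x * w x + σ x * (δ ^ 2 / 4) := by
            have hw2 : w x ^ 2 = v x * w x + δ ^ 2 / 4 := by linear_combination hwid x
            rw [hw2]; ring
          have hψ := hψ01 (v x)
          have hgr : deriv η (v x) ^ 2 * G.gradSq v x ≤ deriv η (v x) * G.gradSq v x := by
            have : deriv η (v x) ^ 2 ≤ deriv η (v x) := by nlinarith [hψ.1, hψ.2]
            exact mul_le_mul_of_nonneg_right this (hgrad0 x)
          nlinarith [hgr, le_abs_self (σ x), sq_nonneg δ]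
        have hii : Integrable (fun x ↦ 6 * G.gradSq w x + σ x * w x ^ 2) μ :=
          integrable_of_continuous h
            ((continuous_const.mul (continuous_innerDual_mvfderiv G hw1 hw1)).add (hσ.mul (hwc.pow 2)))
        have hij : Integrable (fun x ↦ 6 * (deriv η (v x) * G.gradSq v x) + σ x * v x * w x) μ :=
          integrable_of_continuous h
            ((continuous_const.mul (((hηC.continuous_deriv (by simp)).comp hvc).mul hgradvc)).add
              ((hσ.mul hvc).mul hwc))
        have hik : Integrable (fun x ↦ δ ^ 2 / 4 * |σ x|) μ :=
          integrable_of_continuous h (continuous_const.mul hσ.abs)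
        have hisum : Integrable (fun x ↦
            (6 * (deriv η (v x) * G.gradSq v x) + σ x * v x * w x) + δ ^ 2 / 4 * |σ x|) μ :=
          integrable_of_continuous h
            (((continuous_const.mul (((hηC.continuous_deriv (by simp)).comp hvc).mul hgradvc)).add
              ((hσ.mul hvc).mul hwc)).add (continuous_const.mul hσ.abs))
        calc ∫ x, (6 * G.gradSq w x + σ x * w x ^ 2) ∂μ
            ≤ ∫ x, ((6 * (deriv η (v x) * G.gradSq v x) + σ x * v x * w x) + δ ^ 2 / 4 * |σ x|) ∂μ :=
              integral_mono hii hisum hpt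
          _ = ∫ x, w x ∂μ + δ ^ 2 / 4 * K₀ := by
              rw [integral_add hij hik, integral_const_mul, hident]
          _ ≤ δ ^ 2 / 4 * K₀ := by
              have : ∫ x, w x ∂μ ≤ 0 := integral_nonpos fun x ↦ hwle x
              linarith
      have hlow : c * Real.sqrt (∫ x, vm x ^ 4 ∂μ) ≤ c * Real.sqrt (∫ x, w x ^ 4 ∂μ) := by
        refine mul_le_mul_of_nonneg_left (Real.sqrt_le_sqrt (integral_mono
          (integrable_of_continuous h (hvmc.pow 4)) (integrable_of_continuous h (hwc.pow 4))
          fun x ↦ ?_)) hc.le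
        have h0 : 0 ≤ vm x := le_max_right _ _
        have h1 : vm x ≤ -w x := hwvm x
        calc vm x ^ 4 ≤ (-w x) ^ 4 := by gcongr
          _ = w x ^ 4 := by ring
      exact hlow.trans (hcoerw.trans hup)
    -- hence `∫ (v⁻)⁴ = 0` and `v⁻ = 0`
    have hI0 : 0 ≤ ∫ x, vm x ^ 4 ∂μ := integral_nonneg fun x ↦ by positivity
    have hsqrt0 : Real.sqrt (∫ x, vm x ^ 4 ∂μ) = 0 := by
      by_contra hne
      have hpos : 0 < Real.sqrt (∫ x, vm x ^ 4 ∂μ) := lt_of_le_of_ne (Real.sqrt_nonneg _) (Ne.symm hne)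
      have hcp : 0 < c * Real.sqrt (∫ x, vm x ^ 4 ∂μ) := mul_pos hc hpos
      -- choose `δ` with `δ²/4 · K₀ < c √…`
      set δ : ℝ := Real.sqrt (c * Real.sqrt (∫ x, vm x ^ 4 ∂μ) / (K₀ + 1)) with hδ
      have hδpos : 0 < δ := Real.sqrt_pos.2 (div_pos hcp (by linarith))
      have h1 := key δ hδpos
      rw [hδ, Real.sq_sqrt (div_pos hcp (by linarith)).le] at h1
      have h2 : c * Real.sqrt (∫ x, vm x ^ 4 ∂μ) / (K₀ + 1) / 4 * K₀ <
          c * Real.sqrt (∫ x, vm x ^ 4 ∂μ) := by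
        rw [div_div, div_mul_eq_mul_div, div_lt_iff₀ (by nlinarith)]
        nlinarith
      linarith
    have hI : ∫ x, vm x ^ 4 ∂μ = 0 := by rwa [Real.sqrt_eq_zero hI0] at hsqrt0
    have hae := (integral_eq_zero_iff_of_nonneg (fun x ↦ pow_nonneg (le_max_right (-v x) 0) 4)
      (integrable_of_continuous h (hvmc.pow 4))).1 hI
    have hfun : (fun x ↦ vm x ^ 4) = fun _ ↦ (0 : ℝ) :=
      (Continuous.ae_eq_iff_eq μ (hvmc.pow 4) continuous_const).1 hae
    intro x
    have hx : vm x ^ 4 = 0 := congr_fun hfun x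
    have hvm0 : vm x = 0 := (pow_eq_zero_iff (by norm_num)).1 hx
    have : -v x ≤ 0 := by
      have := le_max_left (-v x) 0
      rw [show max (-v x) 0 = vm x from rfl, hvm0] at this
      exact this
    linarith
  /- (ii) `v > 0` by E. Hopf's minimum principle -/
  intro x₀
  by_contra hle
  have hx₀ : v x₀ = 0 := le_antisymm (not_lt.1 hle) (hnonneg x₀)
  have hc' : Continuous fun x ↦ max (σ x) 0 / 6 := (hσ.max continuous_const).div_const 6
  have hc0 : ∀ x, 0 ≤ max (σ x) 0 / 6 := fun x ↦ by positivity
  have hpde : ∀ x, G.dalembertian v x ≤ max (σ x) 0 / 6 * v x := fun x ↦ by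
    rw [heq x]
    have h1 : σ x * v x ≤ max (σ x) 0 * v x :=
      mul_le_mul_of_nonneg_right (le_max_left _ _) (hnonneg x)
    linarith
  have hev := G.dalembertian_supersolution_eventually_eq hG hc' hc0 hv2 hpde le_rfl hnonneg hx₀
  have hΔ0 : G.dalembertian v x₀ = 0 := G.dalembertian_eq_zero_of_eventuallyEq_zero hev
  have := heq x₀
  rw [hΔ0, hx₀] at this
  norm_num at this

end PDE


end Positivity

/-! ### The PDE step and the proof of the named fact -/

section Final

open scoped ENNReal

/-- **The analytic half of Chen–Zhu's Cor. 2.2 in dimension four, in the tree's frame-wise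
form.** On a closed Riemannian `4`-manifold `(M, G)` whose isotropic Yamabe quotient is bounded
below on smooth positive functions — `c (∫u⁴)^{1/2} ≤ ∫ (6|∇u|²_G + 3 iso_min u²) dV_G`, `c > 0` —
there is a smooth positive `u` with `2Δ_G u < u · iso_min` everywhere, i.e. `−6Δ_G u + σ_G u > 0`
for `σ_G = 3 iso_min` (the modified scalar curvature `σ_{u²G} = u⁻³(−6Δ_G u + σ_G u)` of `u²G` is
positive, Chen–Zhu (2.8) at `n = 4`). Proof: coercivity for all smooth functions
(`coercive_of_coercive_pos`), a smooth `σ̃` with `σ_G − ε < σ̃ < σ_G` (`exists_contMDiff_sub_lt_lt`)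
keeping coercivity with constant `c/2` (`∫φ² ≤ √Vol (∫φ⁴)^{1/2}`), the weak solution of
`−6Δu + σ̃u = 1` (`exists_veryWeakSolution_of_coercive`), its smoothness
(`exists_contMDiff_ae_eq_dalembertian_sub_mul_eq`) and positivity
(`pos_of_dalembertian_eq_of_coercive`); finally `2Δu = (σ̃u − 1)/3 < σ_G u/3 = u · iso_min`.
[cite: ChenZhu2014, Cor. 2.2 and §2 (2.8)] [cite: GurskyLebrun1999, Prop. 3] -/
theorem exists_pos_smooth_two_mul_dalembertian_lt {M : Type*} [TopologicalSpace M] [T2Space M]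
    [ChartedSpace (EuclideanSpace ℝ (Fin 4)) M] [IsManifold (𝓡 4) ∞ M] [CompactSpace M]
    [MeasurableSpace M] [BorelSpace M]
    (G : PseudoRiemannianMetric (𝓡 4) ∞ (EuclideanSpace ℝ (Fin 4)) (TangentSpace (𝓡 4) : M → Type _))
    (hG : G.IsRiemannian) [G.HasLeviCivita]
    (hY : ∃ c : ℝ, 0 < c ∧ ∀ u : M → ℝ, ContMDiff (𝓡 4) 𝓘(ℝ, ℝ) ∞ u → (∀ x, 0 < u x) →
      c * Real.sqrt (∫ x, u x ^ 4 ∂(riemannianMeasure (G.toContMDiffRiemannianMetric hG))) ≤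
        ∫ x, (6 * G.gradSq u x + 3 * minIsotropicCurvature G x * u x ^ 2)
          ∂(riemannianMeasure (G.toContMDiffRiemannianMetric hG))) :
    ∃ u : M → ℝ, ContMDiff (𝓡 4) 𝓘(ℝ, ℝ) ∞ u ∧ (∀ x, 0 < u x) ∧
      ∀ x, 2 * G.dalembertian u x < u x * minIsotropicCurvature G x := by
  classical
  obtain ⟨c, hc, hY⟩ := hY
  set h := G.toContMDiffRiemannianMetric hG with hh
  haveI hLC : (ofRiemannian h).HasLeviCivita := ‹G.HasLeviCivita›
  set μ : Measure M := riemannianMeasure h with hμ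
  haveI : IsFiniteMeasure μ := isFiniteMeasure_riemannianMeasure h
  haveI : μ.IsOpenPosMeasure := isOpenPosMeasure_riemannianMeasure h
  haveI : Nontrivial (EuclideanSpace ℝ (Fin 4)) := Module.nontrivial_of_finrank_pos (R := ℝ)
    (by rw [finrank_euclideanSpace_fin]; norm_num)
  set K : M → ℝ := minIsotropicCurvature G with hK
  have hKc : Continuous K := continuous_minIsotropicCurvature hG
  have h3Kc : Continuous fun x ↦ 3 * K x := continuous_const.mul hKc
  -- (1) coercivity for all smooth functions
  have hcoer3 : ∀ φ : M → ℝ, ContMDiff (𝓡 4) 𝓘(ℝ, ℝ) ∞ φ →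
      c * Real.sqrt (∫ x, φ x ^ 4 ∂μ) ≤ ∫ x, (6 * G.gradSq φ x + (3 * K x) * φ x ^ 2) ∂μ :=
    fun φ hφ ↦ coercive_of_coercive_pos G hG (V := fun x ↦ 3 * K x) h3Kc hc.le
      (fun u hu hpos ↦ by simpa only [hK] using hY u hu hpos) hφ
  -- (2) the smooth potential `σ̃` below `3 K`
  set Vol : ℝ := (μ univ).toReal with hVol
  have hVol0 : 0 ≤ Real.sqrt Vol := Real.sqrt_nonneg _
  set ε : ℝ := c / (2 * (Real.sqrt Vol + 1)) with hε
  have hεpos : 0 < ε := div_pos hc (by positivity)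
  have hεVol : ε * Real.sqrt Vol ≤ c / 2 := by
    rw [hε, div_mul_eq_mul_div, div_le_iff₀ (by positivity)]
    nlinarith
  obtain ⟨σ', hσ's, hσ'⟩ := exists_contMDiff_sub_lt_lt (m := 4) (σ := fun x ↦ 3 * K x) h3Kc hεpos
  have hσ'c : Continuous σ' := hσ's.continuous
  -- coercivity of the modified form with constant `c/2`
  have hcoerσ : ∀ φ : M → ℝ, ContMDiff (𝓡 4) 𝓘(ℝ, ℝ) ∞ φ →
      c / 2 * Real.sqrt (∫ x, φ x ^ 4 ∂μ) ≤ ∫ x, (6 * G.gradSq φ x + σ' x * φ x ^ 2) ∂μ := by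
    intro φ hφ
    have hφc : Continuous φ := hφ.continuous
    have hφ1 : ContMDiff (𝓡 4) 𝓘(ℝ, ℝ) 1 φ := hφ.of_le (by exact_mod_cast le_top)
    have hgradc : Continuous (G.gradSq φ) := continuous_innerDual_mvfderiv G hφ1 hφ1
    have h1 := hcoer3 φ hφ
    have hCS := integral_sq_le_sqrt_measure_mul_sqrt (μ := μ) hφc
    have hi1 : Integrable (fun x ↦ 6 * G.gradSq φ x + (3 * K x) * φ x ^ 2) μ :=
      integrable_of_continuous h ((continuous_const.mul hgradc).add (h3Kc.mul (hφc.pow 2)))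
    have hi2 : Integrable (fun x ↦ 6 * G.gradSq φ x + σ' x * φ x ^ 2) μ :=
      integrable_of_continuous h ((continuous_const.mul hgradc).add (hσ'c.mul (hφc.pow 2)))
    have hi3 : Integrable (fun x ↦ ε * φ x ^ 2) μ :=
      integrable_of_continuous h (continuous_const.mul (hφc.pow 2))
    have hi4 : Integrable (fun x ↦ (6 * G.gradSq φ x + σ' x * φ x ^ 2) + ε * φ x ^ 2) μ :=
      integrable_of_continuous h (((continuous_const.mul hgradc).add (hσ'c.mul (hφc.pow 2))).add
        (continuous_const.mul (hφc.pow 2)))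
    have hcmp : ∫ x, (6 * G.gradSq φ x + (3 * K x) * φ x ^ 2) ∂μ ≤
        ∫ x, (6 * G.gradSq φ x + σ' x * φ x ^ 2) ∂μ + ε * ∫ x, φ x ^ 2 ∂μ := by
      rw [← integral_const_mul, ← integral_add hi2 hi3]
      refine integral_mono hi1 hi4 fun x ↦ ?_
      have := (hσ' x).1
      nlinarith [sq_nonneg (φ x)]
    have hsq0 : 0 ≤ Real.sqrt (∫ x, φ x ^ 4 ∂μ) := Real.sqrt_nonneg _
    have hεI : ε * ∫ x, φ x ^ 2 ∂μ ≤ c / 2 * Real.sqrt (∫ x, φ x ^ 4 ∂μ) :=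
      calc ε * ∫ x, φ x ^ 2 ∂μ ≤ ε * (Real.sqrt Vol * Real.sqrt (∫ x, φ x ^ 4 ∂μ)) :=
            mul_le_mul_of_nonneg_left hCS hεpos.le
        _ = (ε * Real.sqrt Vol) * Real.sqrt (∫ x, φ x ^ 4 ∂μ) := by ring
        _ ≤ c / 2 * Real.sqrt (∫ x, φ x ^ 4 ∂μ) := mul_le_mul_of_nonneg_right hεVol hsq0
    linarith
  -- (3) the weak solution of `Δu − (σ̃/6)u = −1/6`
  have hfs : ContMDiff (𝓡 4) 𝓘(ℝ, ℝ) ∞ fun x ↦ σ' x / 6 := hσ's.div_const 6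
  have hfc : Continuous fun x ↦ σ' x / 6 := hσ'c.div_const 6
  have hcoer' : ∀ φ : M → ℝ, ContMDiff (𝓡 4) 𝓘(ℝ, ℝ) ∞ φ →
      c / 12 * Real.sqrt (∫ x, φ x ^ 4 ∂riemannianMeasure h) ≤
        ∫ x, ((ofRiemannian h).innerDual x (mvfderiv (𝓡 4) φ x).toLinearMap
          (mvfderiv (𝓡 4) φ x).toLinearMap + σ' x / 6 * φ x ^ 2) ∂riemannianMeasure h := by
    intro φ hφ
    have h1 := hcoerσ φ hφ
    have heq : ∫ x, ((ofRiemannian h).innerDual x (mvfderiv (𝓡 4) φ x).toLinearMap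
        (mvfderiv (𝓡 4) φ x).toLinearMap + σ' x / 6 * φ x ^ 2) ∂riemannianMeasure h =
        6⁻¹ * ∫ x, (6 * G.gradSq φ x + σ' x * φ x ^ 2) ∂μ := by
      rw [← integral_const_mul]
      refine integral_congr_ae (Eventually.of_forall fun x ↦ ?_)
      show G.gradSq φ x + σ' x / 6 * φ x ^ 2 = 6⁻¹ * (6 * G.gradSq φ x + σ' x * φ x ^ 2)
      ring
    rw [heq]
    change c / 12 * Real.sqrt (∫ x, φ x ^ 4 ∂μ) ≤ _
    nlinarith
  obtain ⟨U, hU4, hUweak⟩ := exists_veryWeakSolution_of_coercive h (c := c / 12) (by positivity)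
    (f := fun x ↦ σ' x / 6) (g := fun _ ↦ -1 / 6) hfc continuous_const hcoer'
  -- (4) smoothness of the weak solution
  have hUint : Integrable U μ := hU4.integrable (by norm_num)
  obtain ⟨v, hv, -, hveq⟩ := exists_contMDiff_ae_eq_dalembertian_sub_mul_eq h hUint hfs
    contMDiff_const hUweak
  have heq : ∀ x, G.dalembertian v x = (σ' x * v x - 1) / 6 := fun x ↦ by
    have h1 : G.dalembertian v x - σ' x / 6 * v x = -1 / 6 := hveq x
    linarith
  -- (5) positivity
  have hvpos : ∀ x, 0 < v x :=
    pos_of_dalembertian_eq_of_coercive G hG hσ'c hv heq (c := c / 2) (by positivity) hcoerσ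
  -- (6) conclusion: `2Δv = (σ̃v − 1)/3 < (3K) v/3 = v K`
  refine ⟨v, hv, hvpos, fun x ↦ ?_⟩
  rw [heq x]
  have h1 : σ' x * v x < 3 * K x * v x := mul_lt_mul_of_pos_right (hσ' x).2 (hvpos x)
  show 2 * ((σ' x * v x - 1) / 6) < v x * K x
  nlinarith

/-- **Chen–Zhu 2014, Cor. 2.2 (= Gursky–LeBrun 1999, Prop. 3) with §3, dimension four — the named
fact `chenZhu2014_conformal_pic_four` holds**: on a closed smooth Riemannian `4`-manifold `(M, G)`
whose isotropic Yamabe quotient is bounded below on the conformal class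
(`∃ c > 0, ∀ u > 0 smooth, c(∫u⁴ dV_G)^{1/2} ≤ ∫ (6|∇u|²_G + 3 iso_min u²) dV_G`), some smooth
conformal metric `G' = u²G` (`u > 0` smooth) is Riemannian with positive isotropic curvature.
Proof: the analytic step `exists_pos_smooth_two_mul_dalembertian_lt` produces a smooth `u > 0` with
`2Δ_G u < u · iso_min` (positivity of Chen–Zhu's `σ_{u²G} = u⁻³(−6Δ_G u + σ_G u)`, (2.8) at
`n = 4`, for a metric in the conformal class, Cor. 2.2), and the geometric step
`exists_conformal_sq_hasPositiveIsotropicCurvature` turns this into positive isotropic curvature of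
`u²G` (§3: "`σ_g > 0` … In other words, `(M⁴, g)` has positive isotropic curvature").
[cite: ChenZhu2014, Cor. 2.2 (PDF p. 7) and §3, first paragraph of the proof of Thm. 1.1 (PDF p. 9)]
[cite: GurskyLebrun1999, Prop. 3] -/
theorem chenZhu2014_conformal_pic_four_holds : chenZhu2014_conformal_pic_four := by
  intro M _ _ _ _ _ _ _ _ G hG _ hY
  obtain ⟨u, hu, hpos, hlt⟩ := exists_pos_smooth_two_mul_dalembertian_lt G hG hY
  obtain ⟨G', hval, hR, hpic⟩ := exists_conformal_sq_hasPositiveIsotropicCurvature G hG hu hpos hlt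
  exact ⟨G', u, hpos, hval, hR, hpic⟩

end Final

end Literature.Geometry.Riemannian

end
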